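import Mathlib.Analysis.MeanInequalities
import Mathlib.Analysis.PSeries
import Mathlib.Analysis.Normed.Group.Tannery
import Mathlib.Analysis.SpecificLimits.Normed
import Literature.NumberTheory.ConnesConsani2021.QuasiInnerProducts
import Literature.NumberTheory.ConnesConsani2021.QuasiInnerArchResidues
import HarnessLib

/-!
# Connes–Consani, *Quasi-inner functions and local factors* (JNT 2021), Prop. 4.5 — step 1:
# the `p`-polar part `φ` of `ρ_∞ρ_p` and `σ = φ∘ψ ∈ C(S¹)`

A. Connes, C. Consani, *Quasi-inner functions and local factors*, J. Number Theory 226 (2021) 139–167 =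
arXiv:2008.10974 [bib: `ConnesConsani2021QuasiInner`], §4.3 Proposition 4.5 «The function `κ(v)κ_p(v)`
belongs to `C(S¹) + H^∞(𝒰)`» (named fact `QuasiInner.prop_4_5`, `QuasiInnerProducts.lean`), proof, FIRST STEP
(p. 13, arXiv chunk p0013:L7–L35): «The delicate part of the pole contribution for the function
`k(v) = κ(v)κ_p(v)` comes from the poles of `κ_p`.  When considered in `∂ℂ_−` this contribution takes the form
`φ(z) := ((p−1)/(p log p)) Σ_{ℤ∖{0}} ρ_∞(2πin/log p) (z − 2πin/log p)⁻¹`.  We consider the restriction of `φ`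
to the critical line `∂ℂ_−` and extend it by the value `φ(∞) := 0` as a function on the projective line
`P¹(ℝ)`.  By (uinfim) one has `|ρ_∞(2πin/log p)| = O(n^{-1/2})` and this suffices to show that the series
defining `φ(z)` is absolutely convergent … Thus we have shown that the function `φ` is continuous on the
projective line `P¹(ℝ)` and hence that `σ = φ∘ψ ∈ C(S¹)` … `σ(1) = 0`.»

LABEL: RH-FREE corpus literature (function theory of the ratios of local `L`-factors `ρ_∞`, `ρ_p`; P5 §4).
bears_on: W-C/W-P (P5 sequel vocabulary; no leaf role).  WHAT THIS IS NOT: any claim about RH — nothing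
here bears on the truth of RH.

## Contents (definitions with bodies + theorems; no named facts)

* `primePole p n = 2πin/log p` — the poles of `ρ_p` (Lemma 3.1 (ii), t17's `lemma_3_1_ii`; residue
  `(1 − p⁻¹)/log p`, t17's `tendsto_sub_mul_rhoPrime_pole`);
* `primePolarPart p z = φ(z)` (as a `tsum` over `ℤ`, the `n = 0` term being `0`) and its terms
  `primePolarTerm`;
* §2 `norm_rhoArch_mul_I_le`, `norm_rhoArch_primePole_le`: `|ρ_∞(it)| ≤ C_b|t|^{-1/2}` (`|t| ≥ b`), from the
  row's PROVED Lemma 4.3 (`norm_rhoArch_mul_I`, exact `coth` formula) and the monotonicity of `coth`;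
* §3–§4 `summable_primePolarTerm`, `continuousAt_primePolarPart`, `continuousOn_primePolarPart`: absolute
  convergence and continuity of `φ` off the imaginary axis (termwise domination `K|n|^{-3/2}` on boxes);
* §5 `tendsto_primePolarPart_vertical`: `φ(σ + is) → 0` as `|s| → ∞` for every `σ ≠ 0` — head terms tend to
  `0`, the tail is uniformly small by HÖLDER's inequality with exponents `3, 3/2` (as in print, p0013:L41)
  against the uniform shifted-lattice bound `Σ_n (1 + |s − bn|)^{-3/2} ≤ C` (p0013:L43 analogue).  The print
  states the sharper rate `|φ(½ + is)| = O(|s|^{-1/2} log|s|)` (p0013:L15–L31); only the limit, which is what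
  the `C(S¹)` statement consumes, is formalised — TODO(rate);
* §6 `primePolarCircle p x = σ(e^{2πix})` (`σ = φ∘ψ`, `ψ = cayley`, value `0` at `v = 1`),
  `continuous_primePolarCircle`, `primePolarCircle_periodic`: **`σ ∈ C(S¹)`, `σ(1) = 0`**.

* §7 (append #1) `circlePullback g` (`= g∘ψ` on `S¹` parametrised by `x ↦ e^{2πix}`, value `0` at
  `v = 1 = ψ⁻¹(∞)`) and **the pullback principle** `continuous_circlePullback`: `g` continuous at every point
  of the critical line and `g(½ + is) → 0` (`|s| → ∞`) ⇒ `circlePullback g ∈ C(S¹)` — the sentence «continuous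
  on `P¹(ℝ)` hence `∘ψ ∈ C(S¹)`» made reusable (`primePolarCircle = circlePullback φ`, rfl);
* §8 `continuous_circlePullback_inv_pow`: `z⁻ᵏ∘ψ ∈ C(S¹)` (`k ≥ 1`) — the double-pole part `φ₂ = a z⁻² + b z⁻¹`
  for any coefficients (in print `a = 2(p−1)/(p log p)`, `b = ((p−3)log p − (p−1)(γ + 2log π − Γ′/Γ(½)))/(p log p)`);
* §9 `archProductPolarPart p = φ₁ = Σ_{n≥1} c_n(p)/(z + 2n)` (`c_n(p) = thm44Coeff p n`, eq. (4.3)),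
  `abs_thm44Coeff_le` (`|c_n(p)| ≤ 4√π π^{2n}/n!`, from t17's `abs_thm23Coeff_le` and `|ρ_p(−2n)| ≤ 1`),
  continuity on `{Re z > −1}`, decay along vertical lines, `φ₁∘ψ ∈ C(S¹)`;
* §10 `continuous_circlePullback_polarParts`: for a prime `p` and any `a, b`, «the sum of the polar parts
  `πρ^{p,∞} := φ + φ₁ + φ₂` is in `C(S¹)` after composition with `ψ`» — the candidate continuous part `c` of the
  boundary-value form of `QuasiInner.prop_4_5`.

* §11 (append #2) `norm_primePolarPart_le_of_one_le_abs_re`, `norm_primePolarPart_le_of_im_half_lattice`: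
  «a uniform bound for `|φ(z)|` on `C_{R,m}`» — `φ` is bounded on `{|Re z| ≥ 1}` and on the horizontal lines
  `Im z = (2m+1)π/log p` (`R = (2m+1)π/log p`, half-way between the poles), uniformly in `m`, by Hölder's
  inequality with `p = 3`, `q = 3/2` exactly as printed (p0013:L39–L43); and (append #3)
  `norm_primePolarPart_le_of_forall_le_norm_sub`: `φ` is bounded off the `r₀`-neighbourhoods of the poles
  of `ρ_p`, uniformly on `ℂ` (the form used for the maximum principle around the poles), and
  `norm_archProductPolarPart_le_of_forall_le_norm_add`: the same for `φ₁` off its poles `−2n`;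
  `exists_norm_rhoPrime_le_of_forall_le_norm_sub`: `ρ_p` bounded on `{Re z ≤ 1}` off its pole neighbourhoods
  (periodicity + compactness) — inputs of the maximum-principle step of the `H^∞` half;
* §13 ERRATUM + `archProductPolarPartRes`: the display «φ₁» prints two DIFFERENT series (the second = eq. (4.3)
  coefficients with the operator normalisation `1/(4n+1)`); the actual polar part of `ρ_∞ρ_p` at `−2n` has
  coefficients `archProductResCoeff p n = ρ_p(−2n)·Res_{−2n}ρ_∞ = −(4n+1)·thm44Coeff p n`
  (`archProductResCoeff_eq`, `rhoPrime_neg_two_mul`); the same analysis (`…Res` lemmas,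
  `continuous_circlePullback_polarPartsRes`) — this is the `φ₁` the `C(S¹)+H^∞` decomposition uses.
* §14 `exists_analyticAt_rhoArch_mul_rhoPrime_sub_polar_neg`: the same removable-singularity statement at the
  poles `−2n` of `ρ_∞` with the TRUE coefficients `archProductResCoeff` (t17's `exists_rhoArch_eq_div_sub_pole`).
* §12 `exists_analyticAt_rhoArch_mul_rhoPrime_sub_polar`: at each pole `2πin/log p` (`n ≠ 0`) of `ρ_p`,
  `ρ_∞ρ_p` minus the `n`-th polar term of `φ` has a removable singularity (Lemma 3.1 (ii) order `−1` + the residue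
  `(1 − p⁻¹)/log p` + analyticity of `ρ_∞` off the real axis; divided difference `dslope`).

The remaining step of the printed proof (the Cauchy-formula identification of the negative Fourier modes of
`κκ_p − (φ+φ₁+φ₂)∘ψ` on the contours `C_{R,m}`, p0013:L44–L45 — the `H^∞(𝒰)` half) is the §2 machinery of
t17/t16's `display_aminusk` / `prop_2_4` discharges (`QuasiInnerArchResidues.lean`) and is not in this file.

## References
* A. Connes, C. Consani, arXiv:2008.10974 = J. Number Theory 226 (2021), §3 Lemma 3.1, §4.2 Lemma 4.3,
  §4.3 Prop. 4.5 and its proof p. 13. [ConnesConsani2021QuasiInner]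
-/

noncomputable section

open Filter Topology Complex Set
open scoped Real Nat

namespace Literature.NumberTheory.ConnesConsani2021

namespace QuasiInner

/-! ## 1. The poles `2πin/log p` of `ρ_p` and the `p`-polar part `φ` -/

/-- RH-FREE. The poles `2πin/log p` (`n ∈ ℤ`) of `ρ_p` (Lemma 3.1 (ii), t17's `lemma_3_1_ii`), written as in
`tendsto_sub_mul_rhoPrime_pole`. [cite: ConnesConsani2021QuasiInner, Lemma 3.1 (ii) (arXiv chunk p0008:L11)] -/
def primePole (p : ℕ) (n : ℤ) : ℂ := 2 * π * I * n / Real.log p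

/-- RH-FREE. The `n`-th term `ρ_∞(2πin/log p)·(z − 2πin/log p)⁻¹` (`n ≠ 0`; `0` for `n = 0`) of the
`p`-polar part (4.5′) of `ρ_∞ρ_p`. [cite: ConnesConsani2021QuasiInner, Prop 4.5 proof, first display (arXiv chunk p0013:L9)] -/
def primePolarTerm (p : ℕ) (z : ℂ) (n : ℤ) : ℂ :=
  if n = 0 then 0 else rhoArch (primePole p n) / (z - primePole p n)

/-- RH-FREE. **The `p`-polar part of `ρ_∞ρ_p`** (proof of Prop. 4.5, first display):
`φ(z) := ((p−1)/(p log p)) Σ_{n ∈ ℤ∖{0}} ρ_∞(2πin/log p) · (z − 2πin/log p)⁻¹` — the contribution of the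
poles of `ρ_p` (residue `(1 − p⁻¹)/log p`, t17's `tendsto_sub_mul_rhoPrime_pole`) weighted by the values of
the other factor `ρ_∞`.  (As a `tsum`; absolutely convergent off the imaginary axis,
`summable_primePolarTerm`.) [cite: ConnesConsani2021QuasiInner, Prop 4.5 proof, first display (arXiv chunk p0013:L9)] -/
def primePolarPart (p : ℕ) (z : ℂ) : ℂ :=
  (1 - (p : ℂ)⁻¹) / Real.log p * ∑' n : ℤ, primePolarTerm p z n

/-- RH-FREE. `2πin/log p = (2πn/log p)·i`. [cite: ConnesConsani2021QuasiInner, Lemma 3.1 (ii) (arXiv chunk p0008:L11)] -/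
theorem primePole_eq (p : ℕ) (n : ℤ) : primePole p n = ((2 * π * n / Real.log p : ℝ) : ℂ) * I := by
  unfold primePole
  push_cast
  ring

/-- RH-FREE. `Re(2πin/log p) = 0`. [cite: ConnesConsani2021QuasiInner, Lemma 3.1 (ii) (arXiv chunk p0008:L11)] -/
theorem primePole_re (p : ℕ) (n : ℤ) : (primePole p n).re = 0 := by
  rw [primePole_eq, mul_re, ofReal_re, ofReal_im, I_re, I_im]; ring

/-- RH-FREE. `Im(2πin/log p) = 2πn/log p`. [cite: ConnesConsani2021QuasiInner, Lemma 3.1 (ii) (arXiv chunk p0008:L11)] -/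
theorem primePole_im (p : ℕ) (n : ℤ) : (primePole p n).im = 2 * π * n / Real.log p := by
  rw [primePole_eq, mul_im, ofReal_re, ofReal_im, I_re, I_im]; ring

/-- RH-FREE. `primePolarTerm p z 0 = 0`. [cite: ConnesConsani2021QuasiInner, Prop 4.5 proof, first display (arXiv chunk p0013:L9–L11)] -/
@[simp] theorem primePolarTerm_zero (p : ℕ) (z : ℂ) : primePolarTerm p z 0 = 0 := by
  simp [primePolarTerm]

/-- RH-FREE. The term for `n ≠ 0`. [cite: ConnesConsani2021QuasiInner, Prop 4.5 proof, first display (arXiv chunk p0013:L9–L11)] -/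
theorem primePolarTerm_of_ne_zero (p : ℕ) (z : ℂ) {n : ℤ} (hn : n ≠ 0) :
    primePolarTerm p z n = rhoArch (primePole p n) / (z - primePole p n) := by
  simp [primePolarTerm, hn]

/-! ## 2. `|ρ_∞(it)| = O(|t|^{-1/2})` (from Lemma 4.3) -/

/-- RH-FREE. `coth` is antitone on `(0, ∞)`: `cosh x/sinh x ≤ cosh x₀/sinh x₀` for `0 < x₀ ≤ x`
(`sinh(x − x₀) ≥ 0`). [folklore] -/
private theorem cosh_div_sinh_le_of_le {x₀ x : ℝ} (h₀ : 0 < x₀) (hx : x₀ ≤ x) :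
    Real.cosh x / Real.sinh x ≤ Real.cosh x₀ / Real.sinh x₀ := by
  have hs : 0 < Real.sinh x := Real.sinh_pos_iff.2 (h₀.trans_le hx)
  have hs₀ : 0 < Real.sinh x₀ := Real.sinh_pos_iff.2 h₀
  rw [div_le_div_iff₀ hs hs₀]
  have h : 0 ≤ Real.sinh (x - x₀) := Real.sinh_nonneg_iff.2 (sub_nonneg.2 hx)
  rw [Real.sinh_sub] at h
  linarith

/-- RH-FREE. **`|ρ_∞(it)| ≤ C_b |t|^{-1/2}` for `|t| ≥ b > 0`**, `C_b = (2π coth(πb/2))^{1/2}`: Lemma 4.3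
(`norm_rhoArch_mul_I`: `|ρ_∞(it)| = |t|^{-1/2}(2π coth(π|t|/2))^{1/2}`) and the monotonicity of `coth`
(«By (uinfim) one has `|ρ_∞(2πin/log p)| = O(n^{-1/2})`», p0013:L11).
[cite: ConnesConsani2021QuasiInner, Lemma 4.3 (arXiv chunk p0011:L69); Prop 4.5 proof (p0013:L11)] -/
theorem norm_rhoArch_mul_I_le {b t : ℝ} (hb : 0 < b) (ht : b ≤ |t|) :
    ‖rhoArch (t * I)‖ ≤
      Real.sqrt (2 * π * (Real.cosh (π * b / 2) / Real.sinh (π * b / 2))) * |t| ^ (-(1 / 2 : ℝ)) := by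
  have ht0 : t ≠ 0 := fun h => by rw [h, abs_zero] at ht; linarith
  rw [norm_rhoArch_mul_I t ht0, mul_comm]
  refine mul_le_mul_of_nonneg_right (Real.sqrt_le_sqrt ?_) (by positivity)
  refine mul_le_mul_of_nonneg_left ?_ (by positivity)
  exact cosh_div_sinh_le_of_le (by positivity) (by nlinarith [Real.pi_pos])

/-- RH-FREE. The constant `A_p := (2π coth(π²/log p))^{1/2}·(2π/log p)^{-1/2}` of the bound
`|ρ_∞(2πin/log p)| ≤ A_p |n|^{-1/2}` (an explicit constant for the printed `O(n^{-1/2})`).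
[cite: ConnesConsani2021QuasiInner, Prop 4.5 proof (arXiv chunk p0013:L11)] -/
def rhoArchPoleConst (p : ℕ) : ℝ :=
  Real.sqrt (2 * π * (Real.cosh (π * (2 * π / Real.log p) / 2) / Real.sinh (π * (2 * π / Real.log p) / 2))) *
    (2 * π / Real.log p) ^ (-(1 / 2 : ℝ))

/-- RH-FREE. `0 ≤ A_p`. [folklore] -/
private theorem rhoArchPoleConst_nonneg (p : ℕ) : 0 ≤ rhoArchPoleConst p := by
  unfold rhoArchPoleConst
  exact mul_nonneg (Real.sqrt_nonneg _) (Real.rpow_nonneg (by positivity) _)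

/-- RH-FREE. **`|ρ_∞(2πin/log p)| ≤ A_p |n|^{-1/2}`** for `n ≠ 0` («`|ρ_∞(2πin/log p)| = O(n^{-1/2})`»).
[cite: ConnesConsani2021QuasiInner, Prop 4.5 proof (arXiv chunk p0013:L11)] -/
theorem norm_rhoArch_primePole_le {p : ℕ} (hp : 1 < p) {n : ℤ} (hn : n ≠ 0) :
    ‖rhoArch (primePole p n)‖ ≤ rhoArchPoleConst p * |(n : ℝ)| ^ (-(1 / 2 : ℝ)) := by
  have hlog : 0 < Real.log p := Real.log_pos (by exact_mod_cast hp)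
  have hb : 0 < 2 * π / Real.log p := by positivity
  have hn1 : (1 : ℝ) ≤ |(n : ℝ)| := by
    rw [← Int.cast_abs]; exact_mod_cast Int.one_le_abs hn
  have habs : |2 * π * (n : ℝ) / Real.log p| = 2 * π / Real.log p * |(n : ℝ)| := by
    rw [abs_div, abs_mul, abs_of_pos (by positivity : (0:ℝ) < 2 * π), abs_of_pos hlog]; ring
  have ht : 2 * π / Real.log p ≤ |2 * π * (n : ℝ) / Real.log p| := by
    rw [habs]; nlinarith
  rw [primePole_eq]
  refine (norm_rhoArch_mul_I_le hb ht).trans (le_of_eq ?_)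
  rw [habs, Real.mul_rpow hb.le (abs_nonneg _), rhoArchPoleConst]; ring

/-! ## 3. Distance to the poles and the domination `|term_n(z)| ≤ K|n|^{-3/2}` off the imaginary axis -/

/-- RH-FREE. `|z − 2πin/log p| ≥ |Re z|`. [folklore] -/
private theorem abs_re_le_norm_sub_primePole (p : ℕ) (z : ℂ) (n : ℤ) : |z.re| ≤ ‖z - primePole p n‖ := by
  have h := abs_re_le_norm (z - primePole p n)
  rwa [sub_re, primePole_re, sub_zero] at h

/-- RH-FREE. `|z − 2πin/log p| ≥ |Im z − 2πn/log p|`. [folklore] -/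
private theorem abs_im_sub_le_norm_sub_primePole (p : ℕ) (z : ℂ) (n : ℤ) :
    |z.im - 2 * π * n / Real.log p| ≤ ‖z - primePole p n‖ := by
  have h := abs_im_le_norm (z - primePole p n)
  rwa [sub_im, primePole_im] at h

/-- RH-FREE. **Linear separation from the poles**: if `|Re z| ≥ δ > 0` and `|Im z| ≤ M`, then
`|z − 2πin/log p| ≥ κ|n|` for all `n`, with `κ = min(b/2, δ/(2M/b + 1))`, `b = 2π/log p`
(for `b|n| ≥ 2M` the imaginary parts separate, otherwise `|n| ≤ 2M/b + 1` and the real part does). [cite: ConnesConsani2021QuasiInner, Prop 4.5 proof, first display (arXiv chunk p0013:L9–L11)] -/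
theorem norm_sub_primePole_ge {p : ℕ} (hp : 1 < p) {δ M : ℝ} (hδ : 0 < δ) (hM : 0 ≤ M) {z : ℂ}
    (hre : δ ≤ |z.re|) (him : |z.im| ≤ M) (n : ℤ) :
    min (2 * π / Real.log p / 2) (δ / (2 * M / (2 * π / Real.log p) + 1)) * |(n : ℝ)| ≤
      ‖z - primePole p n‖ := by
  have hlog : 0 < Real.log p := Real.log_pos (by exact_mod_cast hp)
  set b : ℝ := 2 * π / Real.log p with hbdef
  have hb : 0 < b := by positivity
  have hn0 : 0 ≤ |(n : ℝ)| := abs_nonneg _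
  by_cases hcase : 2 * M ≤ b * |(n : ℝ)|
  · -- the imaginary parts separate
    have h1 : b / 2 * |(n : ℝ)| ≤ |z.im - 2 * π * n / Real.log p| := by
      have e : 2 * π * (n : ℝ) / Real.log p = b * n := by rw [hbdef]; ring
      rw [e]
      have h2 : |b * (n : ℝ)| - |z.im| ≤ |z.im - b * n| := by
        have := abs_sub_abs_le_abs_sub (b * n) z.im
        rwa [abs_sub_comm] at this
      rw [abs_mul, abs_of_pos hb] at h2
      linarith
    exact le_trans (mul_le_mul_of_nonneg_right (min_le_left _ _) hn0)
      (h1.trans (abs_im_sub_le_norm_sub_primePole p z n))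
  · -- `|n| < 2M/b + 1`: the real parts separate
    have hlt : |(n : ℝ)| < 2 * M / b + 1 := by
      rw [div_add_one hb.ne', lt_div_iff₀ hb]
      linarith [mul_comm b |(n : ℝ)|]
    have hpos : 0 < 2 * M / b + 1 := by positivity
    have h1 : δ / (2 * M / b + 1) * |(n : ℝ)| ≤ δ := by
      rw [div_mul_eq_mul_div, div_le_iff₀ hpos]
      exact mul_le_mul_of_nonneg_left hlt.le hδ.le
    exact le_trans (mul_le_mul_of_nonneg_right (min_le_right _ _) hn0)
      (h1.trans (hre.trans (abs_re_le_norm_sub_primePole p z n)))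

/-- RH-FREE. The separation constant is positive. [folklore] -/
private theorem primePole_sep_pos {p : ℕ} (hp : 1 < p) {δ M : ℝ} (hδ : 0 < δ) (hM : 0 ≤ M) :
    0 < min (2 * π / Real.log p / 2) (δ / (2 * M / (2 * π / Real.log p) + 1)) := by
  have hlog : 0 < Real.log p := Real.log_pos (by exact_mod_cast hp)
  exact lt_min (by positivity) (by positivity)

/-- RH-FREE. **Domination off the imaginary axis**: for `|Re z| ≥ δ > 0`, `|Im z| ≤ M` and every `n ∈ ℤ`,
`|term_n(z)| ≤ (A_p/κ)·|n|^{-3/2}` (`κ` the separation constant of `norm_sub_primePole_ge`). [cite: ConnesConsani2021QuasiInner, Prop 4.5 proof, first display (arXiv chunk p0013:L9–L11)] -/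
theorem norm_primePolarTerm_le {p : ℕ} (hp : 1 < p) {δ M : ℝ} (hδ : 0 < δ) (hM : 0 ≤ M) {z : ℂ}
    (hre : δ ≤ |z.re|) (him : |z.im| ≤ M) (n : ℤ) :
    ‖primePolarTerm p z n‖ ≤
      rhoArchPoleConst p / min (2 * π / Real.log p / 2) (δ / (2 * M / (2 * π / Real.log p) + 1)) *
        |(n : ℝ)| ^ (-(3 / 2 : ℝ)) := by
  set κ := min (2 * π / Real.log p / 2) (δ / (2 * M / (2 * π / Real.log p) + 1)) with hκ
  have hκ0 : 0 < κ := primePole_sep_pos hp hδ hM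
  have hA := rhoArchPoleConst_nonneg p
  by_cases hn : n = 0
  · subst hn
    rw [primePolarTerm_zero, norm_zero]
    positivity
  have hn1 : (0 : ℝ) < |(n : ℝ)| := by
    rw [← Int.cast_abs]; exact_mod_cast Int.one_le_abs hn
  have hsep : κ * |(n : ℝ)| ≤ ‖z - primePole p n‖ := norm_sub_primePole_ge hp hδ hM hre him n
  have hden : 0 < ‖z - primePole p n‖ := lt_of_lt_of_le (mul_pos hκ0 hn1) hsep
  rw [primePolarTerm_of_ne_zero p z hn, norm_div, div_le_iff₀ hden]
  calc ‖rhoArch (primePole p n)‖ ≤ rhoArchPoleConst p * |(n : ℝ)| ^ (-(1 / 2 : ℝ)) :=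
        norm_rhoArch_primePole_le hp hn
    _ = rhoArchPoleConst p / κ * |(n : ℝ)| ^ (-(3 / 2 : ℝ)) * (κ * |(n : ℝ)|) := by
        have e : |(n : ℝ)| ^ (-(1 / 2 : ℝ)) = |(n : ℝ)| ^ (-(3 / 2 : ℝ)) * |(n : ℝ)| := by
          rw [show (-(1 / 2 : ℝ)) = -(3 / 2 : ℝ) + 1 by norm_num, Real.rpow_add hn1, Real.rpow_one]
        rw [e]
        field_simp
    _ ≤ rhoArchPoleConst p / κ * |(n : ℝ)| ^ (-(3 / 2 : ℝ)) * ‖z - primePole p n‖ := by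
        gcongr

/-- RH-FREE. `Σ_{n ∈ ℤ} |n|^{-3/2} < ∞`. [folklore] -/
private theorem summable_abs_int_rpow_neg_three_halves :
    Summable fun n : ℤ => |(n : ℝ)| ^ (-(3 / 2 : ℝ)) :=
  Real.summable_abs_int_rpow (by norm_num)

/-! ## 4. Absolute convergence and continuity of `φ` off the imaginary axis -/

/-- RH-FREE. **Absolute convergence**: for `Re z ≠ 0` the series `Σ_{n≠0} ρ_∞(2πin/log p)(z − 2πin/log p)⁻¹`
converges absolutely («this suffices to show that the series defining `φ(z)` is absolutely convergent»,
p0013:L11). [cite: ConnesConsani2021QuasiInner, Prop 4.5 proof (arXiv chunk p0013:L11)] -/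
theorem summable_primePolarTerm {p : ℕ} (hp : 1 < p) {z : ℂ} (hz : z.re ≠ 0) :
    Summable (primePolarTerm p z) := by
  have hδ : 0 < |z.re| := abs_pos.2 hz
  have hb := fun n => norm_primePolarTerm_le hp hδ (abs_nonneg z.im) le_rfl le_rfl n
  exact Summable.of_norm_bounded (summable_abs_int_rpow_neg_three_halves.mul_left _) hb

/-- RH-FREE. **Continuity of `φ` off the imaginary axis** (in particular on the critical line `∂ℂ_−`,
«so that `φ` is smooth on `∂ℂ_−`» — continuity is what the `C(S¹)` statement uses).
[cite: ConnesConsani2021QuasiInner, Prop 4.5 proof (arXiv chunk p0013:L11–L13)] -/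
theorem continuousAt_primePolarPart {p : ℕ} (hp : 1 < p) {z₀ : ℂ} (hz₀ : z₀.re ≠ 0) :
    ContinuousAt (primePolarPart p) z₀ := by
  -- an open box around `z₀` on which the terms are uniformly dominated
  set δ : ℝ := |z₀.re| / 2 with hδdef
  set M : ℝ := |z₀.im| + 1 with hMdef
  have hδ : 0 < δ := by have := abs_pos.2 hz₀; positivity
  have hM : 0 ≤ M := by positivity
  set S : Set ℂ := {z | δ < |z.re| ∧ |z.im| < M} with hSdef
  have hSo : IsOpen S := by
    refine IsOpen.inter ?_ ?_
    · exact isOpen_lt continuous_const (continuous_abs.comp Complex.continuous_re)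
    · exact isOpen_lt (continuous_abs.comp Complex.continuous_im) continuous_const
  have hz₀S : z₀ ∈ S := by
    refine ⟨?_, ?_⟩
    · show |z₀.re| / 2 < |z₀.re|
      have := abs_pos.2 hz₀; linarith
    · show |z₀.im| < |z₀.im| + 1
      linarith
  have hcont : ContinuousOn (fun z => ∑' n : ℤ, primePolarTerm p z n) S := by
    refine continuousOn_tsum (fun n => ?_) (summable_abs_int_rpow_neg_three_halves.mul_left
      (rhoArchPoleConst p / min (2 * π / Real.log p / 2) (δ / (2 * M / (2 * π / Real.log p) + 1))))
      (fun n z hz => norm_primePolarTerm_le hp hδ hM hz.1.le hz.2.le n)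
    by_cases hn : n = 0
    · subst hn; simp only [primePolarTerm_zero]; exact continuousOn_const
    · simp only [primePolarTerm_of_ne_zero p _ hn]
      refine continuousOn_const.div (continuousOn_id.sub continuousOn_const) (fun z hz => ?_)
      intro h
      have h1 := abs_re_le_norm_sub_primePole p z n
      rw [h, norm_zero] at h1
      linarith [hz.1, abs_nonneg z.re]
  have hcont' : ContinuousOn (primePolarPart p) S := continuousOn_const.mul hcont
  exact hcont'.continuousAt (hSo.mem_nhds hz₀S)

/-- RH-FREE. `φ` is continuous on `{Re z ≠ 0}` (hence on the critical line `Re z = ½`).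
[cite: ConnesConsani2021QuasiInner, Prop 4.5 proof (arXiv chunk p0013:L11–L13)] -/
theorem continuousOn_primePolarPart {p : ℕ} (hp : 1 < p) :
    ContinuousOn (primePolarPart p) {z | z.re ≠ 0} := fun _ hz =>
  (continuousAt_primePolarPart hp hz).continuousWithinAt


/-! ## 5. Decay of `φ` along vertical lines: `φ(σ + is) → 0` as `|s| → ∞` -/

/-- RH-FREE. On the vertical line `Re z = σ`: `|z − 2πin/log p| ≥ (m/2)(1 + |Im z − 2πn/log p|)`,
`m = min(|σ|, 1)` (the printed `|½ + is − 2πin/log p|⁻¹ ≤ 3(1 + |s − nb|)⁻¹`, p0013:L19, for any line). [cite: ConnesConsani2021QuasiInner, Prop 4.5 proof (arXiv chunk p0013:L19)] -/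
theorem norm_sub_primePole_ge_line (p : ℕ) (σ s : ℝ) (n : ℤ) :
    min |σ| 1 / 2 * (1 + |s - 2 * π * n / Real.log p|) ≤ ‖(σ : ℂ) + s * I - primePole p n‖ := by
  set m := min |σ| 1 with hmdef
  set w : ℂ := (σ : ℂ) + s * I - primePole p n with hw
  have hm1 : m ≤ 1 := min_le_right _ _
  have hre : ((σ : ℂ) + s * I).re = σ := by simp
  have him : ((σ : ℂ) + s * I).im = s := by simp
  have h1 : m ≤ ‖w‖ := by
    have h := abs_re_le_norm_sub_primePole p ((σ : ℂ) + s * I) n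
    rw [hre] at h
    exact (min_le_left _ _).trans h
  have h2 : |s - 2 * π * n / Real.log p| ≤ ‖w‖ := by
    have h := abs_im_sub_le_norm_sub_primePole p ((σ : ℂ) + s * I) n
    rwa [him] at h
  have h3 : m * |s - 2 * π * n / Real.log p| ≤ ‖w‖ :=
    le_trans (mul_le_of_le_one_left (abs_nonneg _) hm1) h2
  have e : m / 2 * (1 + |s - 2 * π * n / Real.log p|) = (m + m * |s - 2 * π * n / Real.log p|) / 2 := by
    ring
  rw [e]
  linarith

/-- RH-FREE. Comparison with the shifted lattice: for `b > 0`, `n₀ = ⌊s/b⌋` and every `n ∈ ℤ`,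
`min(1,b)·max(1, |n − n₀|) ≤ 1 + |s − bn|`. [folklore] -/
private theorem min_mul_max_le_one_add_abs {b : ℝ} (hb : 0 < b) (s : ℝ) (n : ℤ) :
    min 1 b * max 1 |((n - ⌊s / b⌋ : ℤ) : ℝ)| ≤ 1 + |s - b * n| := by
  set n₀ : ℤ := ⌊s / b⌋ with hn₀
  have hc1 : min 1 b ≤ 1 := min_le_left _ _
  have hcb : min 1 b ≤ b := min_le_right _ _
  have hc0 : 0 < min 1 b := lt_min one_pos hb
  by_cases hk : n - n₀ = 0
  · rw [hk, Int.cast_zero, abs_zero, max_eq_left zero_le_one, mul_one]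
    linarith [abs_nonneg (s - b * n)]
  · have hK1 : (1 : ℝ) ≤ |((n - n₀ : ℤ) : ℝ)| := by
      rw [← Int.cast_abs]; exact_mod_cast Int.one_le_abs hk
    rw [max_eq_right hK1]
    have hfl0 : (n₀ : ℝ) ≤ s / b := Int.floor_le _
    have hfl1 : s / b < n₀ + 1 := Int.lt_floor_add_one _
    have habs0 : |s / b - n₀| ≤ 1 := by
      rw [abs_le]; constructor <;> linarith
    have htri : |((n - n₀ : ℤ) : ℝ)| - 1 ≤ |s / b - n| := by
      have h := abs_sub_le (n : ℝ) (s / b) (n₀ : ℝ)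
      -- `|n − n₀| ≤ |n − s/b| + |s/b − n₀|`
      push_cast
      rw [abs_sub_comm (n : ℝ) (s / b)] at h
      linarith
    have hsb : |s - b * n| = b * |s / b - n| := by
      rw [show s - b * n = b * (s / b - n) by field_simp, abs_mul, abs_of_pos hb]
    rw [hsb]
    have hK0 : 0 ≤ |((n - n₀ : ℤ) : ℝ)| - 1 := by linarith
    calc min 1 b * |((n - n₀ : ℤ) : ℝ)| = min 1 b + min 1 b * (|((n - n₀ : ℤ) : ℝ)| - 1) := by ring
      _ ≤ 1 + b * (|((n - n₀ : ℤ) : ℝ)| - 1) := by gcongr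
      _ ≤ 1 + b * |s / b - n| := by gcongr

/-- RH-FREE. `Σ_{k ∈ ℤ} max(1,|k|)^{-3/2} < ∞`. [folklore] -/
private theorem summable_max_one_abs_rpow : Summable fun k : ℤ => (max 1 |(k : ℝ)|) ^ (-(3 / 2 : ℝ)) := by
  have h : (fun k : ℤ => (max 1 |(k : ℝ)|) ^ (-(3 / 2 : ℝ))) =
      Function.update (fun k : ℤ => |(k : ℝ)| ^ (-(3 / 2 : ℝ))) 0 1 := by
    funext k
    by_cases hk : k = 0
    · subst hk; simp
    · rw [Function.update_of_ne hk]
      have : (1 : ℝ) ≤ |(k : ℝ)| := by rw [← Int.cast_abs]; exact_mod_cast Int.one_le_abs hk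
      rw [max_eq_right this]
  rw [h]
  exact summable_abs_int_rpow_neg_three_halves.update 0 1

/-- RH-FREE. **Uniform bound for the shifted sums** `Σ_{n ∈ ℤ} (1 + |s − bn|)^{-3/2} ≤ min(1,b)^{-3/2}·Σ_k max(1,|k|)^{-3/2}`
for every real `s` («one has a uniform bound … of the form `Σ_n |z − 2πin/log p|^{−q} ≤ C`», p0013:L43,
here on vertical lines with `q = 3/2`). [cite: ConnesConsani2021QuasiInner, Prop 4.5 proof (arXiv chunk p0013:L41–L43)] -/
theorem summable_one_add_abs_sub_rpow_and_le {b : ℝ} (hb : 0 < b) (s : ℝ) :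
    Summable (fun n : ℤ => (1 + |s - b * n|) ^ (-(3 / 2 : ℝ))) ∧
      ∑' n : ℤ, (1 + |s - b * n|) ^ (-(3 / 2 : ℝ)) ≤
        (min 1 b) ^ (-(3 / 2 : ℝ)) * ∑' k : ℤ, (max 1 |(k : ℝ)|) ^ (-(3 / 2 : ℝ)) := by
  set n₀ : ℤ := ⌊s / b⌋ with hn₀
  have hc0 : 0 < min 1 b := lt_min one_pos hb
  set g : ℤ → ℝ := fun n => (min 1 b) ^ (-(3 / 2 : ℝ)) * (max 1 |((n - n₀ : ℤ) : ℝ)|) ^ (-(3 / 2 : ℝ))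
    with hgdef
  have hg : Summable g := by
    refine Summable.mul_left _ ?_
    have h := (Equiv.subRight n₀).summable_iff.2 summable_max_one_abs_rpow
    exact h
  have hle : ∀ n : ℤ, (1 + |s - b * n|) ^ (-(3 / 2 : ℝ)) ≤ g n := fun n => by
    have hpos : 0 < min 1 b * max 1 |((n - n₀ : ℤ) : ℝ)| :=
      mul_pos hc0 (lt_of_lt_of_le one_pos (le_max_left _ _))
    have h1 := Real.rpow_le_rpow_of_nonpos hpos (min_mul_max_le_one_add_abs hb s n)
      (by norm_num : (-(3 / 2 : ℝ)) ≤ 0)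
    rw [Real.mul_rpow hc0.le (le_trans zero_le_one (le_max_left _ _))] at h1
    exact h1
  have hnn : ∀ n : ℤ, 0 ≤ (1 + |s - b * n|) ^ (-(3 / 2 : ℝ)) := fun n => by positivity
  have hsum : Summable (fun n : ℤ => (1 + |s - b * n|) ^ (-(3 / 2 : ℝ))) :=
    Summable.of_nonneg_of_le hnn hle hg
  refine ⟨hsum, ?_⟩
  calc ∑' n : ℤ, (1 + |s - b * n|) ^ (-(3 / 2 : ℝ)) ≤ ∑' n : ℤ, g n := Summable.tsum_le_tsum hle hsum hg
    _ = (min 1 b) ^ (-(3 / 2 : ℝ)) * ∑' n : ℤ, (max 1 |((n - n₀ : ℤ) : ℝ)|) ^ (-(3 / 2 : ℝ)) := tsum_mul_left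
    _ = (min 1 b) ^ (-(3 / 2 : ℝ)) * ∑' k : ℤ, (max 1 |(k : ℝ)|) ^ (-(3 / 2 : ℝ)) := by
        congr 1
        exact (Equiv.subRight n₀).tsum_eq (fun k : ℤ => (max 1 |(k : ℝ)|) ^ (-(3 / 2 : ℝ)))

/-- RH-FREE. The dominating sequence `x_n = A_p|n|^{-1/2}` (`0` at `n = 0`). [folklore] -/
private def dX (p : ℕ) (n : ℤ) : ℝ := if n = 0 then 0 else rhoArchPoleConst p * |(n : ℝ)| ^ (-(1 / 2 : ℝ))

/-- RH-FREE. The dominating sequence `y_n(s) = (2/m)(1 + |s − bn|)⁻¹`. [folklore] -/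
private def dY (m b s : ℝ) (n : ℤ) : ℝ := 2 / m * (1 + |s - b * n|)⁻¹

/-- RH-FREE. The tail `x_n·1_{|n| > N}`. [folklore] -/
private def dXtail (p : ℕ) (N : ℕ) (n : ℤ) : ℝ := if (N : ℤ) < |n| then dX p n else 0

/-- RH-FREE. The head `x_n·1_{|n| ≤ N}`. [folklore] -/
private def dXhead (p : ℕ) (N : ℕ) (n : ℤ) : ℝ := if |n| ≤ (N : ℤ) then dX p n else 0

/-- RH-FREE. `x_n ≥ 0`. [folklore] -/
private theorem dX_nonneg (p : ℕ) (n : ℤ) : 0 ≤ dX p n := by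
  unfold dX; split_ifs
  · exact le_rfl
  · exact mul_nonneg (rhoArchPoleConst_nonneg p) (Real.rpow_nonneg (abs_nonneg _) _)

/-- RH-FREE. `y_n(s) ≥ 0`. [folklore] -/
private theorem dY_nonneg {m : ℝ} (hm : 0 < m) (b s : ℝ) (n : ℤ) : 0 ≤ dY m b s n := by
  unfold dY; positivity

/-- RH-FREE. The tail is nonnegative. [folklore] -/
private theorem dXtail_nonneg (p : ℕ) (N : ℕ) (n : ℤ) : 0 ≤ dXtail p N n := by
  unfold dXtail; split_ifs
  · exact dX_nonneg p n
  · exact le_rfl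

/-- RH-FREE. The tail is dominated by `x_n`. [folklore] -/
private theorem dXtail_le (p : ℕ) (N : ℕ) (n : ℤ) : dXtail p N n ≤ dX p n := by
  unfold dXtail; split_ifs
  · exact le_rfl
  · exact dX_nonneg p n

/-- RH-FREE. The head is nonnegative. [folklore] -/
private theorem dXhead_nonneg (p : ℕ) (N : ℕ) (n : ℤ) : 0 ≤ dXhead p N n := by
  unfold dXhead; split_ifs
  · exact dX_nonneg p n
  · exact le_rfl

/-- RH-FREE. The head is dominated by `x_n`. [folklore] -/
private theorem dXhead_le (p : ℕ) (N : ℕ) (n : ℤ) : dXhead p N n ≤ dX p n := by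
  unfold dXhead; split_ifs
  · exact le_rfl
  · exact dX_nonneg p n

/-- RH-FREE. `head + tail = x_n`. [folklore] -/
private theorem dXhead_add_dXtail (p : ℕ) (N : ℕ) (n : ℤ) : dXhead p N n + dXtail p N n = dX p n := by
  unfold dXhead dXtail
  by_cases h : |n| ≤ (N : ℤ)
  · rw [if_pos h, if_neg (not_lt.2 h), add_zero]
  · rw [if_neg h, if_pos (not_le.1 h), zero_add]

/-- RH-FREE. **Termwise domination on the line `Re z = σ`**: `|term_n(σ + is)| ≤ x_n·y_n(s)`. [folklore] -/
private theorem norm_primePolarTerm_le_dX_mul_dY {p : ℕ} (hp : 1 < p) {σ : ℝ} (hσ : σ ≠ 0) (s : ℝ)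
    (n : ℤ) :
    ‖primePolarTerm p ((σ : ℂ) + s * I) n‖ ≤ dX p n * dY (min |σ| 1) (2 * π / Real.log p) s n := by
  have hm : 0 < min |σ| 1 := lt_min (abs_pos.2 hσ) one_pos
  by_cases hn : n = 0
  · subst hn
    rw [primePolarTerm_zero, norm_zero]
    exact mul_nonneg (dX_nonneg p 0) (dY_nonneg hm _ _ _)
  have hX : dX p n = rhoArchPoleConst p * |(n : ℝ)| ^ (-(1 / 2 : ℝ)) := by simp [dX, hn]
  set u : ℝ := |s - 2 * π / Real.log p * n| with hu
  have hu' : |s - 2 * π * n / Real.log p| = u := by rw [hu]; ring_nf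
  have hsep : min |σ| 1 / 2 * (1 + u) ≤ ‖(σ : ℂ) + s * I - primePole p n‖ := by
    rw [← hu']; exact norm_sub_primePole_ge_line p σ s n
  have hden : 0 < ‖(σ : ℂ) + s * I - primePole p n‖ :=
    lt_of_lt_of_le (by positivity) hsep
  rw [primePolarTerm_of_ne_zero p _ hn, norm_div, div_le_iff₀ hden, hX]
  have hY : dY (min |σ| 1) (2 * π / Real.log p) s n * (min |σ| 1 / 2 * (1 + u)) = 1 := by
    rw [dY, ← hu]
    have h1 : (1 + u) ≠ 0 := by positivity
    field_simp
  calc ‖rhoArch (primePole p n)‖ ≤ rhoArchPoleConst p * |(n : ℝ)| ^ (-(1 / 2 : ℝ)) :=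
        norm_rhoArch_primePole_le hp hn
    _ = rhoArchPoleConst p * |(n : ℝ)| ^ (-(1 / 2 : ℝ)) *
          (dY (min |σ| 1) (2 * π / Real.log p) s n * (min |σ| 1 / 2 * (1 + u))) := by rw [hY, mul_one]
    _ ≤ rhoArchPoleConst p * |(n : ℝ)| ^ (-(1 / 2 : ℝ)) *
          (dY (min |σ| 1) (2 * π / Real.log p) s n * ‖(σ : ℂ) + s * I - primePole p n‖) := by
        have h0 : 0 ≤ rhoArchPoleConst p * |(n : ℝ)| ^ (-(1 / 2 : ℝ)) := by rw [← hX]; exact dX_nonneg p n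
        exact mul_le_mul_of_nonneg_left (mul_le_mul_of_nonneg_left hsep (dY_nonneg hm _ _ _)) h0
    _ = _ := by ring

/-- RH-FREE. `Σ x_n³ < ∞` (`x_n³ = A_p³|n|^{-3/2}`). [folklore] -/
private theorem summable_dX_rpow_three (p : ℕ) : Summable fun n : ℤ => dX p n ^ (3 : ℝ) := by
  have hA := rhoArchPoleConst_nonneg p
  refine Summable.of_nonneg_of_le (fun n => Real.rpow_nonneg (dX_nonneg p n) _)
    (fun n => ?_) (summable_abs_int_rpow_neg_three_halves.mul_left (rhoArchPoleConst p ^ (3 : ℝ)))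
  by_cases hn : n = 0
  · subst hn
    simp only [dX, if_true, Int.cast_zero, abs_zero]
    rw [Real.zero_rpow (by norm_num), Real.zero_rpow (by norm_num), mul_zero]
  · simp only [dX, hn, if_false]
    rw [Real.mul_rpow hA (Real.rpow_nonneg (abs_nonneg _) _), ← Real.rpow_mul (abs_nonneg _)]
    norm_num

/-- RH-FREE. `Σ y_n(s)^{3/2} ≤ K₀` uniformly in `s`, `K₀ = (2/m)^{3/2}·min(1,b)^{-3/2}·Σ_k max(1,|k|)^{-3/2}`. [folklore] -/
private theorem summable_dY_rpow_and_le {m b : ℝ} (hm : 0 < m) (hb : 0 < b) (s : ℝ) :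
    Summable (fun n : ℤ => dY m b s n ^ (3 / 2 : ℝ)) ∧
      ∑' n : ℤ, dY m b s n ^ (3 / 2 : ℝ) ≤
        (2 / m) ^ (3 / 2 : ℝ) * ((min 1 b) ^ (-(3 / 2 : ℝ)) * ∑' k : ℤ, (max 1 |(k : ℝ)|) ^ (-(3 / 2 : ℝ))) := by
  obtain ⟨hs, hle⟩ := summable_one_add_abs_sub_rpow_and_le hb s
  have hpt : ∀ n : ℤ, dY m b s n ^ (3 / 2 : ℝ) = (2 / m) ^ (3 / 2 : ℝ) * (1 + |s - b * n|) ^ (-(3 / 2 : ℝ)) := by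
    intro n
    rw [dY, Real.mul_rpow (by positivity) (by positivity), Real.inv_rpow (by positivity),
      Real.rpow_neg (by positivity)]
  simp_rw [hpt]
  exact ⟨hs.mul_left _, by rw [tsum_mul_left]; exact mul_le_mul_of_nonneg_left hle (by positivity)⟩

/-- RH-FREE. **Hölder on the tail** (`p = 3`, `q = 3/2`, as in print p0013:L41):
`Σ_n x_n 1_{|n|>N} y_n(s) ≤ (Σ_{|n|>N} x_n³)^{1/3}·K₀^{2/3}`, and the product is summable. [cite: ConnesConsani2021QuasiInner, Prop 4.5 proof (arXiv chunk p0013:L39–L43)] -/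
private theorem tsum_dXtail_mul_dY_le {p : ℕ} {m b : ℝ} (hm : 0 < m) (hb : 0 < b) (s : ℝ) (N : ℕ) :
    Summable (fun n : ℤ => dXtail p N n * dY m b s n) ∧
      ∑' n : ℤ, dXtail p N n * dY m b s n ≤
        (∑' n : ℤ, dXtail p N n ^ (3 : ℝ)) ^ (1 / 3 : ℝ) *
          ((2 / m) ^ (3 / 2 : ℝ) * ((min 1 b) ^ (-(3 / 2 : ℝ)) * ∑' k : ℤ, (max 1 |(k : ℝ)|) ^ (-(3 / 2 : ℝ)))) ^
            (2 / 3 : ℝ) := by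
  have hpq : (3 : ℝ).HolderConjugate (3 / 2) := Real.holderConjugate_iff.2 ⟨by norm_num, by norm_num⟩
  have htail3 : Summable fun n : ℤ => dXtail p N n ^ (3 : ℝ) :=
    Summable.of_nonneg_of_le (fun n => Real.rpow_nonneg (dXtail_nonneg p N n) _)
      (fun n => Real.rpow_le_rpow (dXtail_nonneg p N n) (dXtail_le p N n) (by norm_num))
      (summable_dX_rpow_three p)
  obtain ⟨hY, hYle⟩ := summable_dY_rpow_and_le hm hb s
  obtain ⟨hsum, hholder⟩ := Real.summable_and_inner_le_Lp_mul_Lq_tsum_of_nonneg hpq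
    (dXtail_nonneg p N) (dY_nonneg hm b s) htail3 hY
  refine ⟨hsum, hholder.trans ?_⟩
  rw [show (1 / (3 / 2 : ℝ)) = (2 / 3 : ℝ) by norm_num]
  have h0 : 0 ≤ (∑' n : ℤ, dXtail p N n ^ (3 : ℝ)) ^ (1 / 3 : ℝ) :=
    Real.rpow_nonneg (tsum_nonneg fun n => Real.rpow_nonneg (dXtail_nonneg p N n) _) _
  refine mul_le_mul_of_nonneg_left (Real.rpow_le_rpow (tsum_nonneg fun n => ?_) hYle (by norm_num)) h0
  exact Real.rpow_nonneg (dY_nonneg hm b s n) _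

/-- RH-FREE. **Head + tail bound** for `Σ_n |term_n(σ + is)|`. [folklore] -/
private theorem tsum_norm_primePolarTerm_le {p : ℕ} (hp : 1 < p) {σ : ℝ} (hσ : σ ≠ 0) (s : ℝ) (N : ℕ) :
    ∑' n : ℤ, ‖primePolarTerm p ((σ : ℂ) + s * I) n‖ ≤
      (∑ n ∈ Finset.Icc (-(N : ℤ)) N, dXhead p N n * dY (min |σ| 1) (2 * π / Real.log p) s n) +
        (∑' n : ℤ, dXtail p N n ^ (3 : ℝ)) ^ (1 / 3 : ℝ) *
          ((2 / min |σ| 1) ^ (3 / 2 : ℝ) * ((min 1 (2 * π / Real.log p)) ^ (-(3 / 2 : ℝ)) *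
            ∑' k : ℤ, (max 1 |(k : ℝ)|) ^ (-(3 / 2 : ℝ)))) ^ (2 / 3 : ℝ) := by
  have hlog : 0 < Real.log p := Real.log_pos (by exact_mod_cast hp)
  set m : ℝ := min |σ| 1 with hmdef
  set b : ℝ := 2 * π / Real.log p with hbdef
  have hm : 0 < m := lt_min (abs_pos.2 hσ) one_pos
  have hb : 0 < b := by positivity
  have hzre : ((σ : ℂ) + s * I).re ≠ 0 := by simp [hσ]
  -- summability of the three products
  obtain ⟨htailY, htail_le⟩ := tsum_dXtail_mul_dY_le (p := p) hm hb s N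
  obtain ⟨hXY, -⟩ := tsum_dXtail_mul_dY_le (p := p) hm hb s 0
  have htail0 : ∀ n : ℤ, dXtail p 0 n = dX p n := fun n => by
    unfold dXtail dX
    by_cases hn : n = 0
    · subst hn; simp
    · rw [if_pos (by simpa using hn)]
  simp_rw [htail0] at hXY
  have hheadY : Summable (fun n : ℤ => dXhead p N n * dY m b s n) :=
    Summable.of_nonneg_of_le (fun n => mul_nonneg (dXhead_nonneg p N n) (dY_nonneg hm b s n))
      (fun n => mul_le_mul_of_nonneg_right (dXhead_le p N n) (dY_nonneg hm b s n)) hXY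
  -- the chain
  have h1 : ∑' n : ℤ, ‖primePolarTerm p ((σ : ℂ) + s * I) n‖ ≤ ∑' n : ℤ, dX p n * dY m b s n :=
    Summable.tsum_le_tsum (fun n => norm_primePolarTerm_le_dX_mul_dY hp hσ s n)
      (summable_primePolarTerm hp hzre).norm hXY
  have h2 : ∑' n : ℤ, dX p n * dY m b s n =
      (∑' n : ℤ, dXhead p N n * dY m b s n) + ∑' n : ℤ, dXtail p N n * dY m b s n := by
    rw [← hheadY.tsum_add htailY]
    refine tsum_congr (fun n => ?_)
    rw [← add_mul, dXhead_add_dXtail]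
  have h3 : ∑' n : ℤ, dXhead p N n * dY m b s n =
      ∑ n ∈ Finset.Icc (-(N : ℤ)) N, dXhead p N n * dY m b s n := by
    refine tsum_eq_sum (fun n hn => ?_)
    have h : ¬ |n| ≤ (N : ℤ) := by
      intro h
      exact hn (Finset.mem_Icc.2 (abs_le.1 h))
    simp [dXhead, h]
  rw [h2, h3] at h1
  exact h1.trans (add_le_add le_rfl htail_le)

/-- RH-FREE. The tail `Σ_{|n|>N} x_n³ → 0` as `N → ∞` (Tannery / dominated convergence for sums). [folklore] -/
private theorem tendsto_tsum_dXtail_rpow_three (p : ℕ) :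
    Tendsto (fun N : ℕ => ∑' n : ℤ, dXtail p N n ^ (3 : ℝ)) atTop (𝓝 0) := by
  have h := tendsto_tsum_of_dominated_convergence (𝓕 := atTop) (f := fun (N : ℕ) (n : ℤ) => dXtail p N n ^ (3 : ℝ))
    (g := fun _ => (0 : ℝ)) (bound := fun n => dX p n ^ (3 : ℝ)) (summable_dX_rpow_three p) ?_ ?_
  · simpa using h
  · intro n
    refine tendsto_const_nhds.congr' ?_
    filter_upwards [eventually_ge_atTop n.natAbs] with N hN
    have h : ¬ ((N : ℤ) < |n|) := by
      rw [not_lt, ← Int.natCast_natAbs]; exact_mod_cast hN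
    simp only [dXtail, h, if_false]
    rw [Real.zero_rpow (by norm_num)]
  · refine Filter.Eventually.of_forall fun N n => ?_
    rw [Real.norm_eq_abs, abs_of_nonneg (Real.rpow_nonneg (dXtail_nonneg p N n) _)]
    exact Real.rpow_le_rpow (dXtail_nonneg p N n) (dXtail_le p N n) (by norm_num)

/-- RH-FREE. Each `y_n(s) → 0` as `|s| → ∞`. [folklore] -/
private theorem tendsto_dY_cocompact {m : ℝ} (b : ℝ) (n : ℤ) :
    Tendsto (fun s : ℝ => dY m b s n) (cocompact ℝ) (𝓝 0) := by
  have h1 : Tendsto (fun s : ℝ => 1 + |s - b * n|) (cocompact ℝ) atTop := by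
    have h := tendsto_atTop_add_const_right (cocompact ℝ) (1 - |b * n|)
      (tendsto_norm_cocompact_atTop (E := ℝ))
    refine tendsto_atTop_mono (fun s => ?_) h
    have := abs_sub_abs_le_abs_sub s (b * n)
    rw [Real.norm_eq_abs]
    linarith
  have h2 := h1.inv_tendsto_atTop
  have h3 : Tendsto (fun s : ℝ => 2 / m * (1 + |s - b * n|)⁻¹) (cocompact ℝ) (𝓝 (2 / m * 0)) :=
    h2.const_mul (2 / m)
  rw [mul_zero] at h3
  exact h3

/-- RH-FREE. **Decay of the absolutely convergent series along vertical lines**: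
`Σ_n |term_n(σ + is)| → 0` as `|s| → ∞` (`σ ≠ 0`) — head terms tend to `0` individually, the tail is
uniformly small by Hölder.  (The print shows the rate `O(|s|^{-1/2} log|s|)` on `σ = ½`, p0013:L15–L31;
only the limit is formalised here — TODO(rate).) [cite: ConnesConsani2021QuasiInner, Prop 4.5 proof (arXiv chunk p0013:L15–L33)] -/
theorem tendsto_tsum_norm_primePolarTerm {p : ℕ} (hp : 1 < p) {σ : ℝ} (hσ : σ ≠ 0) :
    Tendsto (fun s : ℝ => ∑' n : ℤ, ‖primePolarTerm p ((σ : ℂ) + s * I) n‖) (cocompact ℝ) (𝓝 0) := by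
  set K : ℝ := ((2 / min |σ| 1) ^ (3 / 2 : ℝ) * ((min 1 (2 * π / Real.log p)) ^ (-(3 / 2 : ℝ)) *
    ∑' k : ℤ, (max 1 |(k : ℝ)|) ^ (-(3 / 2 : ℝ)))) ^ (2 / 3 : ℝ) with hK
  rw [Metric.tendsto_nhds]
  intro ε hε
  -- choose `N` with a small tail
  have hT : Tendsto (fun N : ℕ => (∑' n : ℤ, dXtail p N n ^ (3 : ℝ)) ^ (1 / 3 : ℝ) * K) atTop (𝓝 0) := by
    have h := ((tendsto_tsum_dXtail_rpow_three p).rpow_const (p := (1 / 3 : ℝ))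
      (Or.inr (by norm_num))).mul_const K
    rwa [Real.zero_rpow (by norm_num), zero_mul] at h
  obtain ⟨N, hN⟩ := (Filter.eventually_atTop.1 (Metric.tendsto_nhds.1 hT (ε / 2) (half_pos hε)))
  have hN' : (∑' n : ℤ, dXtail p N n ^ (3 : ℝ)) ^ (1 / 3 : ℝ) * K < ε / 2 := by
    have h := hN N le_rfl
    rw [Real.dist_eq, sub_zero] at h
    exact lt_of_abs_lt h
  -- the head tends to `0`
  have hH : Tendsto (fun s : ℝ => ∑ n ∈ Finset.Icc (-(N : ℤ)) N,
      dXhead p N n * dY (min |σ| 1) (2 * π / Real.log p) s n) (cocompact ℝ) (𝓝 0) := by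
    have h := tendsto_finsetSum (Finset.Icc (-(N : ℤ)) N) (fun n _ =>
      (tendsto_dY_cocompact (m := min |σ| 1) (2 * π / Real.log p) n).const_mul (dXhead p N n))
    simpa using h
  have hH' := Metric.tendsto_nhds.1 hH (ε / 2) (half_pos hε)
  filter_upwards [hH'] with s hs
  rw [Real.dist_eq, sub_zero] at hs ⊢
  have h0 : 0 ≤ ∑' n : ℤ, ‖primePolarTerm p ((σ : ℂ) + s * I) n‖ := tsum_nonneg fun n => norm_nonneg _
  rw [abs_of_nonneg h0]
  have hle := tsum_norm_primePolarTerm_le hp hσ s N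
  have hs' := lt_of_abs_lt hs
  linarith

/-- RH-FREE. **`φ(σ + is) → 0` as `|s| → ∞`** for every `σ ≠ 0`; on the critical line `σ = ½` this is
«`φ` … extended by the value `φ(∞) := 0` as a function on the projective line `P¹(ℝ)`» being continuous at
`∞` (p0013:L11, L33). [cite: ConnesConsani2021QuasiInner, Prop 4.5 proof (arXiv chunk p0013:L11–L33)] -/
theorem tendsto_primePolarPart_vertical {p : ℕ} (hp : 1 < p) {σ : ℝ} (hσ : σ ≠ 0) :
    Tendsto (fun s : ℝ => primePolarPart p ((σ : ℂ) + s * I)) (cocompact ℝ) (𝓝 0) := by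
  have hzre : ∀ s : ℝ, ((σ : ℂ) + s * I).re ≠ 0 := fun s => by simp [hσ]
  have h := (tendsto_tsum_norm_primePolarTerm hp hσ).const_mul ‖(1 - (p : ℂ)⁻¹) / Real.log p‖
  rw [mul_zero] at h
  refine squeeze_zero_norm (fun s => ?_) h
  rw [primePolarPart, norm_mul]
  exact mul_le_mul_of_nonneg_left (norm_tsum_le_tsum_norm (summable_primePolarTerm hp (hzre s)).norm)
    (norm_nonneg _)


/-! ## 6. `σ := φ ∘ ψ ∈ C(S¹)` -/

/-- RH-FREE. **The boundary function `σ = φ∘ψ` on `S¹`**, parametrised by `x ∈ ℝ` (`v = e^{2πix}`,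
`ψ = cayley`) and extended by the value `0` at `v = 1` (`= ψ⁻¹(∞)`, «extend it by the value `φ(∞) := 0`»).
[cite: ConnesConsani2021QuasiInner, Prop 4.5 proof (arXiv chunk p0013:L11, L33)] -/
def primePolarCircle (p : ℕ) (x : ℝ) : ℂ :=
  if Complex.exp (2 * π * I * x) = 1 then 0 else primePolarPart p (cayley (Complex.exp (2 * π * I * x)))

/-- RH-FREE. `|e^{2πix}| = 1`. [folklore] -/
private theorem norm_exp_two_pi_mul_I_mul (x : ℝ) : ‖Complex.exp (2 * π * I * x)‖ = 1 := by
  rw [show (2 * π * I * x : ℂ) = ((2 * π * x : ℝ) : ℂ) * I by push_cast; ring]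
  exact Complex.norm_exp_ofReal_mul_I _

/-- RH-FREE. `σ` is `1`-periodic. [cite: ConnesConsani2021QuasiInner, Prop 4.5 proof (arXiv chunk p0013:L33–L35)] -/
theorem primePolarCircle_periodic (p : ℕ) : Function.Periodic (primePolarCircle p) 1 := by
  intro x
  have h : Complex.exp (2 * π * I * ((x + 1 : ℝ) : ℂ)) = Complex.exp (2 * π * I * x) := by
    rw [show (2 * π * I * ((x + 1 : ℝ) : ℂ)) = 2 * π * I * x + 2 * π * I by push_cast; ring,
      Complex.exp_add, Complex.exp_two_pi_mul_I, mul_one]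
  simp only [primePolarCircle, h]

/-- RH-FREE. On the circle, `|Im ψ(v)| = |v + 1|/|v − 1|` (`ψ(v) − ½ = (v+1)/(v−1)` is purely imaginary). [cite: ConnesConsani2021QuasiInner, Introduction, the map ψ (arXiv chunk p0003:L26); Prop 4.5 proof (p0013:L33)] -/
theorem abs_im_cayley_of_norm_eq_one {v : ℂ} (hv : ‖v‖ = 1) :
    |(cayley v).im| = ‖v + 1‖ / ‖v - 1‖ := by
  have h := cayley_eq_half_add_of_norm_eq_one hv
  have h3 : (v + 1) / (v - 1) = cayley v - 1 / 2 := by rw [cayley]; ring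
  have h2 : (v + 1) / (v - 1) = ((cayley v).im : ℂ) * I := by
    rw [h3]
    set t : ℝ := (cayley v).im with ht
    rw [h]; ring
  rw [← norm_div, h2, norm_mul, Complex.norm_I, mul_one, Complex.norm_real, Real.norm_eq_abs]

/-- RH-FREE. Near `v = 1` on the circle the point `ψ(v)` is high up the critical line:
`0 < |v − 1| ≤ δ ≤ 1 ⇒ |Im ψ(v)| ≥ 1/δ`. [cite: ConnesConsani2021QuasiInner, Introduction, the map ψ (arXiv chunk p0003:L26); Prop 4.5 proof (p0013:L33)] -/
theorem inv_le_abs_im_cayley {v : ℂ} (hv : ‖v‖ = 1) {δ : ℝ} (hδ1 : δ ≤ 1) (hv1 : 0 < ‖v - 1‖)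
    (hvδ : ‖v - 1‖ ≤ δ) : 1 / δ ≤ |(cayley v).im| := by
  have hδ : 0 < δ := lt_of_lt_of_le hv1 hvδ
  rw [abs_im_cayley_of_norm_eq_one hv]
  have h1 : 1 ≤ ‖v + 1‖ := by
    have h : (2 : ℝ) - ‖v - 1‖ ≤ ‖v + 1‖ := by
      have := norm_sub_norm_le (2 : ℂ) (1 - v)
      rw [show (2 : ℂ) - (1 - v) = v + 1 by ring, norm_sub_rev 1 v] at this
      norm_num at this
      linarith
    linarith
  rw [div_le_div_iff₀ hδ hv1, one_mul]
  calc ‖v - 1‖ ≤ δ := hvδ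
    _ = δ * 1 := (mul_one δ).symm
    _ ≤ δ * ‖v + 1‖ := mul_le_mul_of_nonneg_left h1 hδ.le
    _ = ‖v + 1‖ * δ := mul_comm _ _

/-- RH-FREE. Continuity of `σ` at the points `v ≠ 1` (continuity of `φ` on the critical line and of `ψ`
away from `1`). [cite: ConnesConsani2021QuasiInner, Prop 4.5 proof (arXiv chunk p0013:L11–L13)] -/
theorem continuousAt_primePolarCircle_of_ne {p : ℕ} (hp : 1 < p) {x₀ : ℝ}
    (hx₀ : Complex.exp (2 * π * I * x₀) ≠ 1) : ContinuousAt (primePolarCircle p) x₀ := by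
  have he : Continuous fun x : ℝ => Complex.exp (2 * π * I * x) :=
    Complex.continuous_exp.comp (continuous_const.mul Complex.continuous_ofReal)
  set v₀ := Complex.exp (2 * π * I * x₀) with hv₀
  have hcay : ContinuousAt cayley v₀ := by
    unfold cayley
    exact continuousAt_const.add ((continuousAt_id.add continuousAt_const).div
      (continuousAt_id.sub continuousAt_const) (sub_ne_zero.2 hx₀))
  have hre : (cayley v₀).re ≠ 0 := by
    rw [cayley_re_of_norm_eq_one (norm_exp_two_pi_mul_I_mul x₀)]; norm_num
  have hφ : ContinuousAt (primePolarPart p) (cayley v₀) := continuousAt_primePolarPart hp hre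
  have hcomp : ContinuousAt ((primePolarPart p ∘ cayley) ∘ fun x : ℝ => Complex.exp (2 * π * I * x)) x₀ :=
    ContinuousAt.comp (g := primePolarPart p ∘ cayley) (f := fun x : ℝ => Complex.exp (2 * π * I * x))
      (x := x₀) (hφ.comp hcay) he.continuousAt
  refine hcomp.congr ?_
  filter_upwards [he.continuousAt.eventually_ne hx₀] with x hx
  simp only [Function.comp, primePolarCircle, hx, if_false]

/-- RH-FREE. An `∃ R`-form of the decay on the critical line: `∀ ε > 0 ∃ R ∀ s, |s| ≥ R ⇒ |φ(½ + is)| < ε`. [cite: ConnesConsani2021QuasiInner, Prop 4.5 proof (arXiv chunk p0013:L33–L35)] -/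
theorem exists_norm_primePolarPart_half_lt {p : ℕ} (hp : 1 < p) {ε : ℝ} (hε : 0 < ε) :
    ∃ R : ℝ, ∀ s : ℝ, R ≤ |s| → ‖primePolarPart p ((1 / 2 : ℝ) + s * I)‖ < ε := by
  have h := Metric.tendsto_nhds.1 (tendsto_primePolarPart_vertical hp (σ := 1 / 2) (by norm_num)) ε hε
  rw [cocompact_eq_atBot_atTop, Filter.eventually_sup, Filter.eventually_atBot, Filter.eventually_atTop] at h
  obtain ⟨⟨R₁, h₁⟩, ⟨R₂, h₂⟩⟩ := h
  refine ⟨max (-R₁) R₂, fun s hs => ?_⟩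
  have hs' := (max_le_iff.1 hs)
  rcases le_or_gt 0 s with h0 | h0
  · have := h₂ s (by rw [abs_of_nonneg h0] at hs'; exact hs'.2)
    rwa [dist_zero_right] at this
  · have := h₁ s (by rw [abs_of_neg h0] at hs'; linarith [hs'.1])
    rwa [dist_zero_right] at this

/-- RH-FREE. Continuity of `σ` at `v = 1` with the value `σ(1) = 0` (the decay of `φ` at `∞`):
«the function `φ` is continuous on the projective line `P¹(ℝ)` and hence `σ = φ∘ψ ∈ C(S¹)` … `σ(1) = 0`».
[cite: ConnesConsani2021QuasiInner, Prop 4.5 proof (arXiv chunk p0013:L33–L35)] -/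
theorem continuousAt_primePolarCircle_of_eq {p : ℕ} (hp : 1 < p) {x₀ : ℝ}
    (hx₀ : Complex.exp (2 * π * I * x₀) = 1) : ContinuousAt (primePolarCircle p) x₀ := by
  have he : Continuous fun x : ℝ => Complex.exp (2 * π * I * x) :=
    Complex.continuous_exp.comp (continuous_const.mul Complex.continuous_ofReal)
  have hval : primePolarCircle p x₀ = 0 := by simp [primePolarCircle, hx₀]
  rw [ContinuousAt, hval, Metric.tendsto_nhds]
  intro ε hε
  obtain ⟨R, hR⟩ := exists_norm_primePolarPart_half_lt hp hε
  set R' : ℝ := max R 1 with hR'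
  have hR'0 : 0 < R' := lt_of_lt_of_le one_pos (le_max_right _ _)
  set δ : ℝ := min 1 (1 / R') with hδdef
  have hδ0 : 0 < δ := lt_min one_pos (by positivity)
  have hδ1 : δ ≤ 1 := min_le_left _ _
  have hnear : ∀ᶠ x : ℝ in 𝓝 x₀, ‖Complex.exp (2 * π * I * (x : ℂ)) - 1‖ < δ := by
    have h := Metric.tendsto_nhds.1 (he.continuousAt (x := x₀)) δ hδ0
    simp only [hx₀, dist_eq_norm] at h
    exact h
  filter_upwards [hnear] with x hx
  rw [dist_zero_right]
  by_cases h1 : Complex.exp (2 * π * I * x) = 1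
  · simp [primePolarCircle, h1, hε]
  · rw [show primePolarCircle p x = primePolarPart p (cayley (Complex.exp (2 * π * I * x))) by
      simp only [primePolarCircle, h1, if_false]]
    set v := Complex.exp (2 * π * I * x) with hv
    have hvn : ‖v‖ = 1 := norm_exp_two_pi_mul_I_mul x
    have hv1 : 0 < ‖v - 1‖ := norm_pos_iff.2 (sub_ne_zero.2 h1)
    have him : R ≤ |(cayley v).im| := by
      have h := inv_le_abs_im_cayley hvn hδ1 hv1 hx.le
      have h2 : R' ≤ 1 / δ := by
        rw [le_div_iff₀ hδ0]
        calc R' * δ ≤ R' * (1 / R') := mul_le_mul_of_nonneg_left (min_le_right _ _) hR'0.le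
          _ = 1 := by field_simp
      exact (le_max_left _ _).trans (h2.trans h)
    have hc : cayley v = ((1 / 2 : ℝ) : ℂ) + ((cayley v).im : ℂ) * I := by
      have h := cayley_eq_half_add_of_norm_eq_one hvn
      set t : ℝ := (cayley v).im with ht
      rw [h]; push_cast; ring
    rw [hc]
    exact hR _ him

/-- RH-FREE. **`σ = φ∘ψ ∈ C(S¹)`** (Prop. 4.5, proof, step 1: «Thus we have shown that the function `φ` is
continuous on the projective line `P¹(ℝ)` and hence that `σ = φ∘ψ ∈ C(S¹)`»): the `1`-periodic boundary
function `x ↦ σ(e^{2πix})` is continuous on `ℝ`.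
[cite: ConnesConsani2021QuasiInner, Prop 4.5 proof (arXiv chunk p0013:L33–L35)] -/
theorem continuous_primePolarCircle {p : ℕ} (hp : 1 < p) : Continuous (primePolarCircle p) := by
  refine continuous_iff_continuousAt.2 fun x => ?_
  by_cases h : Complex.exp (2 * π * I * x) = 1
  · exact continuousAt_primePolarCircle_of_eq hp h
  · exact continuousAt_primePolarCircle_of_ne hp h

/-! ## 7. The `ψ`-pullback principle: continuous on `∂ℂ_−` and vanishing at `∞` ⇒ `∘ψ ∈ C(S¹)` -/

/-- RH-FREE. **Pullback to the circle by `ψ`**, extended by `0` at `v = 1 = ψ⁻¹(∞)`: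
`circlePullback g x = g(ψ(e^{2πix}))` for `e^{2πix} ≠ 1`, `0` otherwise («We consider the restriction … to the
critical line `∂ℂ_−` and extend it by the value … `(∞) := 0` as a function on the projective line `P¹(ℝ)`»).
[cite: ConnesConsani2021QuasiInner, Prop 4.5 proof (arXiv chunk p0013:L11, L33)] -/
def circlePullback (g : ℂ → ℂ) (x : ℝ) : ℂ :=
  if Complex.exp (2 * π * I * x) = 1 then 0 else g (cayley (Complex.exp (2 * π * I * x)))

/-- RH-FREE. `σ = circlePullback φ` (definitional). [cite: ConnesConsani2021QuasiInner, Prop 4.5 proof (arXiv chunk p0013:L33)] -/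
theorem primePolarCircle_eq_circlePullback (p : ℕ) : primePolarCircle p = circlePullback (primePolarPart p) := rfl

/-- RH-FREE. The pullback is `1`-periodic. [cite: ConnesConsani2021QuasiInner, Introduction, the map ψ (arXiv chunk p0003:L26); Prop 4.5 proof (p0013:L33)] -/
theorem circlePullback_periodic (g : ℂ → ℂ) : Function.Periodic (circlePullback g) 1 := by
  intro x
  have h : Complex.exp (2 * π * I * ((x + 1 : ℝ) : ℂ)) = Complex.exp (2 * π * I * x) := by
    rw [show (2 * π * I * ((x + 1 : ℝ) : ℂ)) = 2 * π * I * x + 2 * π * I by push_cast; ring,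
      Complex.exp_add, Complex.exp_two_pi_mul_I, mul_one]
  simp only [circlePullback, h]

/-- RH-FREE. The pullback is additive. [cite: ConnesConsani2021QuasiInner, Introduction, the map ψ (arXiv chunk p0003:L26); Prop 4.5 proof (p0013:L33)] -/
theorem circlePullback_add (f g : ℂ → ℂ) :
    circlePullback (fun z => f z + g z) = fun x => circlePullback f x + circlePullback g x := by
  funext x
  by_cases h : Complex.exp (2 * π * I * x) = 1 <;> simp [circlePullback, h]

/-- RH-FREE. The pullback commutes with scalars. [cite: ConnesConsani2021QuasiInner, Introduction, the map ψ (arXiv chunk p0003:L26); Prop 4.5 proof (p0013:L33)] -/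
theorem circlePullback_const_mul (a : ℂ) (f : ℂ → ℂ) :
    circlePullback (fun z => a * f z) = fun x => a * circlePullback f x := by
  funext x
  by_cases h : Complex.exp (2 * π * I * x) = 1 <;> simp [circlePullback, h]

/-- RH-FREE. Continuity of the pullback at the points `v ≠ 1` from continuity of `g` at `ψ(v)`. [cite: ConnesConsani2021QuasiInner, Introduction, the map ψ (arXiv chunk p0003:L26); Prop 4.5 proof (p0013:L33)] -/
theorem continuousAt_circlePullback_of_ne {g : ℂ → ℂ} {x₀ : ℝ} (hx₀ : Complex.exp (2 * π * I * x₀) ≠ 1)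
    (hg : ContinuousAt g (cayley (Complex.exp (2 * π * I * x₀)))) : ContinuousAt (circlePullback g) x₀ := by
  have he : Continuous fun x : ℝ => Complex.exp (2 * π * I * x) :=
    Complex.continuous_exp.comp (continuous_const.mul Complex.continuous_ofReal)
  have hcay : ContinuousAt cayley (Complex.exp (2 * π * I * x₀)) := by
    unfold cayley
    exact continuousAt_const.add ((continuousAt_id.add continuousAt_const).div
      (continuousAt_id.sub continuousAt_const) (sub_ne_zero.2 hx₀))
  have hcomp : ContinuousAt ((g ∘ cayley) ∘ fun x : ℝ => Complex.exp (2 * π * I * x)) x₀ :=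
    ContinuousAt.comp (g := g ∘ cayley) (f := fun x : ℝ => Complex.exp (2 * π * I * x))
      (x := x₀) (hg.comp hcay) he.continuousAt
  refine hcomp.congr ?_
  filter_upwards [he.continuousAt.eventually_ne hx₀] with x hx
  simp only [Function.comp, circlePullback, hx, if_false]

/-- RH-FREE. **Continuity of the pullback at `v = 1`** (value `0`) from the decay `g(½ + is) → 0`, `|s| → ∞`:
as `v → 1` on the circle, `|Im ψ(v)| = |v+1|/|v−1| → ∞`. [cite: ConnesConsani2021QuasiInner, Prop 4.5 proof (arXiv chunk p0013:L33)] -/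
theorem continuousAt_circlePullback_of_eq {g : ℂ → ℂ} {x₀ : ℝ} (hx₀ : Complex.exp (2 * π * I * x₀) = 1)
    (hd : Tendsto (fun s : ℝ => g (((1 / 2 : ℝ) : ℂ) + s * I)) (cocompact ℝ) (𝓝 0)) :
    ContinuousAt (circlePullback g) x₀ := by
  have he : Continuous fun x : ℝ => Complex.exp (2 * π * I * x) :=
    Complex.continuous_exp.comp (continuous_const.mul Complex.continuous_ofReal)
  have hval : circlePullback g x₀ = 0 := by simp [circlePullback, hx₀]
  rw [ContinuousAt, hval, Metric.tendsto_nhds]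
  intro ε hε
  -- `∃ R, |s| ≥ R ⇒ |g(½ + is)| < ε`
  obtain ⟨R, hR⟩ : ∃ R : ℝ, ∀ s : ℝ, R ≤ |s| → ‖g (((1 / 2 : ℝ) : ℂ) + s * I)‖ < ε := by
    have h := Metric.tendsto_nhds.1 hd ε hε
    rw [cocompact_eq_atBot_atTop, Filter.eventually_sup, Filter.eventually_atBot,
      Filter.eventually_atTop] at h
    obtain ⟨⟨R₁, h₁⟩, ⟨R₂, h₂⟩⟩ := h
    refine ⟨max (-R₁) R₂, fun s hs => ?_⟩
    have hs' := max_le_iff.1 hs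
    rcases le_or_gt 0 s with h0 | h0
    · have := h₂ s (by rw [abs_of_nonneg h0] at hs'; exact hs'.2)
      rwa [dist_zero_right] at this
    · have := h₁ s (by rw [abs_of_neg h0] at hs'; linarith [hs'.1])
      rwa [dist_zero_right] at this
  set R' : ℝ := max R 1 with hR'
  have hR'0 : 0 < R' := lt_of_lt_of_le one_pos (le_max_right _ _)
  set δ : ℝ := min 1 (1 / R') with hδdef
  have hδ0 : 0 < δ := lt_min one_pos (by positivity)
  have hδ1 : δ ≤ 1 := min_le_left _ _
  have hnear : ∀ᶠ x : ℝ in 𝓝 x₀, ‖Complex.exp (2 * π * I * (x : ℂ)) - 1‖ < δ := by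
    have h := Metric.tendsto_nhds.1 (he.continuousAt (x := x₀)) δ hδ0
    simp only [hx₀, dist_eq_norm] at h
    exact h
  filter_upwards [hnear] with x hx
  rw [dist_zero_right]
  by_cases h1 : Complex.exp (2 * π * I * x) = 1
  · simp [circlePullback, h1, hε]
  · rw [show circlePullback g x = g (cayley (Complex.exp (2 * π * I * x))) by
      simp only [circlePullback, h1, if_false]]
    set v := Complex.exp (2 * π * I * x) with hv
    have hvn : ‖v‖ = 1 := norm_exp_two_pi_mul_I_mul x
    have hv1 : 0 < ‖v - 1‖ := norm_pos_iff.2 (sub_ne_zero.2 h1)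
    have him : R ≤ |(cayley v).im| := by
      have h := inv_le_abs_im_cayley hvn hδ1 hv1 hx.le
      have h2 : R' ≤ 1 / δ := by
        rw [le_div_iff₀ hδ0]
        calc R' * δ ≤ R' * (1 / R') := mul_le_mul_of_nonneg_left (min_le_right _ _) hR'0.le
          _ = 1 := by field_simp
      exact (le_max_left _ _).trans (h2.trans h)
    have hc : cayley v = ((1 / 2 : ℝ) : ℂ) + ((cayley v).im : ℂ) * I := by
      have h := cayley_eq_half_add_of_norm_eq_one hvn
      set t : ℝ := (cayley v).im with ht
      rw [h]; push_cast; ring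
    rw [hc]
    exact hR _ him

/-- RH-FREE. **The pullback principle**: a function continuous at every point of the critical line
`Re z = ½` and tending to `0` along it at `∞` pulls back by `ψ` to a continuous (`1`-periodic) function on
`S¹` («continuous on the projective line `P¹(ℝ)` and hence … `∘ψ ∈ C(S¹)`»).
[cite: ConnesConsani2021QuasiInner, Prop 4.5 proof (arXiv chunk p0013:L33)] -/
theorem continuous_circlePullback {g : ℂ → ℂ} (hc : ∀ z : ℂ, z.re = 1 / 2 → ContinuousAt g z)
    (hd : Tendsto (fun s : ℝ => g (((1 / 2 : ℝ) : ℂ) + s * I)) (cocompact ℝ) (𝓝 0)) :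
    Continuous (circlePullback g) := by
  refine continuous_iff_continuousAt.2 fun x => ?_
  by_cases h : Complex.exp (2 * π * I * x) = 1
  · exact continuousAt_circlePullback_of_eq h hd
  · exact continuousAt_circlePullback_of_ne h (hc _ (cayley_re_of_norm_eq_one (norm_exp_two_pi_mul_I_mul x)))

/-! ## 8. The double pole at `0`: `ψ⁻ᵏ ∈ C(S¹)` (`φ₂ ∘ ψ`) -/

/-- RH-FREE. `(½ + is)⁻ᵏ → 0` as `|s| → ∞` (`k ≥ 1`). [cite: ConnesConsani2021QuasiInner, Prop 4.5 proof, display φ₂ (arXiv chunk p0013:L37–L38)] -/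
theorem tendsto_inv_pow_vertical {k : ℕ} (hk : 1 ≤ k) :
    Tendsto (fun s : ℝ => (((1 / 2 : ℝ) : ℂ) + s * I)⁻¹ ^ k) (cocompact ℝ) (𝓝 0) := by
  -- `|(½ + is)⁻ᵏ| ≤ |½ + is|⁻¹ ≤ |s|⁻¹` for `|s| ≥ 1`
  have h1 : Tendsto (fun s : ℝ => |s|⁻¹) (cocompact ℝ) (𝓝 0) := by
    have h := (tendsto_norm_cocompact_atTop (E := ℝ)).inv_tendsto_atTop
    refine h.congr' (Filter.Eventually.of_forall fun s => ?_)
    simp [Real.norm_eq_abs]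
  refine squeeze_zero_norm' ?_ h1
  have hev : ∀ᶠ s : ℝ in cocompact ℝ, (1 : ℝ) ≤ |s| := by
    have h := (tendsto_norm_cocompact_atTop (E := ℝ)).eventually_ge_atTop 1
    simpa [Real.norm_eq_abs] using h
  filter_upwards [hev] with s hs
  have hs0 : 0 < |s| := lt_of_lt_of_le one_pos hs
  have hzn : |s| ≤ ‖((1 / 2 : ℝ) : ℂ) + s * I‖ := by
    have h := abs_im_le_norm (((1 / 2 : ℝ) : ℂ) + s * I)
    simpa using h
  have hz1 : 1 ≤ ‖((1 / 2 : ℝ) : ℂ) + s * I‖ := hs.trans hzn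
  rw [norm_pow, norm_inv]
  calc ‖((1 / 2 : ℝ) : ℂ) + s * I‖⁻¹ ^ k ≤ ‖((1 / 2 : ℝ) : ℂ) + s * I‖⁻¹ ^ 1 := by
        refine pow_le_pow_of_le_one (by positivity) ?_ hk
        exact inv_le_one_of_one_le₀ hz1
    _ = ‖((1 / 2 : ℝ) : ℂ) + s * I‖⁻¹ := pow_one _
    _ ≤ |s|⁻¹ := by rw [inv_le_inv₀ (lt_of_lt_of_le one_pos hz1) hs0]; exact hzn

/-- RH-FREE. **`z ↦ z⁻ᵏ` (`k ≥ 1`) pulls back to `C(S¹)`**: the polar part `φ₂` of `ρ_∞ρ_p` at the double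
pole `z = 0` is a combination of `z⁻²` and `z⁻¹` («thus `φ₂∘ψ ∈ C^∞(S¹)`»; continuity is what the `C(S¹)`
statement uses). [cite: ConnesConsani2021QuasiInner, Prop 4.5 proof, display φ₂ (arXiv chunk p0013:L37–L38)] -/
theorem continuous_circlePullback_inv_pow {k : ℕ} (hk : 1 ≤ k) :
    Continuous (circlePullback fun z => z⁻¹ ^ k) := by
  refine continuous_circlePullback (fun z hz => ?_) (tendsto_inv_pow_vertical hk)
  have hz0 : z ≠ 0 := fun h => by rw [h, Complex.zero_re] at hz; norm_num at hz
  exact (continuousAt_id.inv₀ hz0).pow k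

/-! ## 9. The printed series `φ₁` (display φ₁, second form = eq. (4.3) coefficients; see the erratum and §13) -/

/-- RH-FREE. **The series `φ₁` AS PRINTED in the second form of the display** «`φ₁(z) := Σ_{n>0} ρ_p(−2n)·
(√π 2π^{2n}(−1)^n/(Γ(n+1)Γ(n+½)))·(z+2n)⁻¹ = Σ₁^∞ ((−1)^n 2π^{2n+½}(1−p^{−(2n+1)}))/((4n+1)(p^{2n}−1)Γ(n+1)Γ(n+½))
· (z+2n)⁻¹`»: `Σ_{n ≥ 1} thm44Coeff p n/(z + 2n)` (coefficients of eq. (4.3), written as a `tsum` over `n + 1`).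
ERRATUM (t18 g2, recorded — nothing false is stated): the two printed forms DIFFER — the second (= eq. (4.3),
used here) carries the operator normalisation `1/(4n+1)` and the sign of the rank-one expansion of Thm 2.3,
while the ACTUAL polar part of `ρ_∞ρ_p` at `−2n` (the first form) has coefficients
`ρ_p(−2n)·Res_{−2n}ρ_∞ = −(4n+1)·thm44Coeff p n`; that function is `archProductPolarPartRes` below, and it is the
one the `C(S¹) + H^∞` decomposition uses.  Both series enjoy the same analysis (factorially decaying coefficients).
[cite: ConnesConsani2021QuasiInner, Prop 4.5 proof, display φ₁ (arXiv chunk p0013:L36); Thm 4.4 (ii) eq. (4.3) (p0011:L93)] -/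
def archProductPolarPart (p : ℕ) (z : ℂ) : ℂ :=
  ∑' n : ℕ, (thm44Coeff p (n + 1) : ℂ) / (z + 2 * ((n : ℂ) + 1))

/-- RH-FREE. **`|c_n(p)| ≤ |c_n(∞)| ≤ 4√π π^{2n}/n!`** for `p ≥ 2`, `n ≥ 1`: `c_n(p) = thm23Coeff n · ρ_p(−2n)` with
`|ρ_p(−2n)| = (1 − p^{−(2n+1)})/(p^{2n} − 1) ≤ 1` (t17's `abs_thm23Coeff_le`, the row's `thm44Coeff_eq_thm23Coeff_mul`).
[cite: ConnesConsani2021QuasiInner, Thm 4.4 proof (arXiv chunk p0012:L7); Thm 2.3 (p0006:L49)] -/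
theorem abs_thm44Coeff_le {p n : ℕ} (hp : 2 ≤ p) (hn : 1 ≤ n) :
    |thm44Coeff p n| ≤ 4 * Real.sqrt π * (π ^ 2) ^ n / n ! := by
  rw [thm44Coeff_eq_thm23Coeff_mul hp hn, abs_mul]
  have hp1 : (1 : ℝ) < (p : ℝ) ^ (2 * n) := one_lt_pow₀ (by exact_mod_cast hp) (by omega)
  have hp2 : (1 : ℝ) < (p : ℝ) ^ (2 * n + 1) := one_lt_pow₀ (by exact_mod_cast hp) (by omega)
  have hF : |(1 - ((p : ℝ) ^ (2 * n + 1))⁻¹) / (1 - (p : ℝ) ^ (2 * n))| ≤ 1 := by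
    rw [abs_div, abs_of_nonneg (by rw [sub_nonneg]; exact inv_le_one_of_one_le₀ hp2.le),
      abs_of_neg (by linarith), div_le_one (by linarith)]
    have : 0 ≤ ((p : ℝ) ^ (2 * n + 1))⁻¹ := by positivity
    have h3 : (3 : ℝ) ≤ (p : ℝ) ^ (2 * n) - 1 := by
      have h4 : (4 : ℝ) ≤ (p : ℝ) ^ (2 * n) := by
        calc (4 : ℝ) = 2 ^ 2 := by norm_num
          _ ≤ (p : ℝ) ^ 2 := by gcongr; exact_mod_cast hp
          _ ≤ (p : ℝ) ^ (2 * n) := pow_le_pow_right₀ (by exact_mod_cast (by omega : 1 ≤ p)) (by omega)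
      linarith
    linarith
  calc |thm23Coeff n| * |(1 - ((p : ℝ) ^ (2 * n + 1))⁻¹) / (1 - (p : ℝ) ^ (2 * n))|
      ≤ |thm23Coeff n| * 1 := mul_le_mul_of_nonneg_left hF (abs_nonneg _)
    _ ≤ 4 * Real.sqrt π * (π ^ 2) ^ n / n ! := by rw [mul_one]; exact abs_thm23Coeff_le n

/-- RH-FREE. The factorial majorant `4√π π^{2(n+1)}/(n+1)!` is summable. [folklore] -/
private theorem summable_thm44_majorant :
    Summable fun n : ℕ => 4 * Real.sqrt π * (π ^ 2) ^ (n + 1) / (n + 1) ! := by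
  have h := (Real.summable_pow_div_factorial (π ^ 2)).mul_left (4 * Real.sqrt π)
  have h2 : Summable fun n : ℕ => 4 * Real.sqrt π * ((π ^ 2) ^ (n + 1) / (n + 1) !) :=
    (summable_nat_add_iff 1).2 h
  simpa only [mul_div_assoc] using h2

/-- RH-FREE. **Domination of the terms of `φ₁` on `{Re z > −1}`**: `|c_{n+1}/(z + 2(n+1))| ≤ 4√π π^{2(n+1)}/(n+1)!`
(the poles `−2(n+1)` stay at distance `> 1`). [cite: ConnesConsani2021QuasiInner, Prop 4.5 proof (arXiv chunk p0013:L36–L37)] -/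
theorem norm_archProductPolarTerm_le {p : ℕ} (hp : 2 ≤ p) {z : ℂ} (hz : -1 < z.re) (n : ℕ) :
    ‖(thm44Coeff p (n + 1) : ℂ) / (z + 2 * ((n : ℂ) + 1))‖ ≤ 4 * Real.sqrt π * (π ^ 2) ^ (n + 1) / (n + 1) ! := by
  have hre : (z + 2 * ((n : ℂ) + 1)).re = z.re + 2 * (n + 1) := by simp
  have hd1 : (1 : ℝ) ≤ ‖z + 2 * ((n : ℂ) + 1)‖ := by
    have h := abs_re_le_norm (z + 2 * ((n : ℂ) + 1))
    rw [hre] at h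
    have : (1 : ℝ) ≤ |z.re + 2 * (n + 1)| := by
      have h0 : (0 : ℝ) ≤ n := n.cast_nonneg
      rw [abs_of_pos (by linarith)]
      linarith
    exact this.trans h
  rw [norm_div, Complex.norm_real, Real.norm_eq_abs]
  calc |thm44Coeff p (n + 1)| / ‖z + 2 * ((n : ℂ) + 1)‖ ≤ |thm44Coeff p (n + 1)| / 1 :=
        div_le_div_of_nonneg_left (abs_nonneg _) one_pos hd1
    _ = |thm44Coeff p (n + 1)| := div_one _
    _ ≤ 4 * Real.sqrt π * (π ^ 2) ^ (n + 1) / (n + 1) ! := by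
        have := abs_thm44Coeff_le hp (by omega : 1 ≤ n + 1)
        simpa using this

/-- RH-FREE. `φ₁` is continuous on `{Re z > −1}` (locally uniform absolute convergence).
[cite: ConnesConsani2021QuasiInner, Prop 4.5 proof (arXiv chunk p0013:L36–L37)] -/
theorem continuousOn_archProductPolarPart {p : ℕ} (hp : 2 ≤ p) :
    ContinuousOn (archProductPolarPart p) {z | -1 < z.re} := by
  refine continuousOn_tsum (fun n => ?_) summable_thm44_majorant (fun n z hz => norm_archProductPolarTerm_le hp hz n)
  refine continuousOn_const.div (continuousOn_id.add continuousOn_const) (fun z hz => ?_)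
  intro h
  have := congrArg Complex.re h
  simp at this
  have h0 : (0 : ℝ) ≤ n := n.cast_nonneg
  have hz' : -1 < z.re := hz
  linarith

/-- RH-FREE. `φ₁` is continuous at every point of the critical line. [cite: ConnesConsani2021QuasiInner, Prop 4.5 proof (arXiv chunk p0013:L36–L37)] -/
theorem continuousAt_archProductPolarPart {p : ℕ} (hp : 2 ≤ p) {z : ℂ} (hz : -1 < z.re) :
    ContinuousAt (archProductPolarPart p) z :=
  (continuousOn_archProductPolarPart hp).continuousAt
    ((isOpen_lt continuous_const Complex.continuous_re).mem_nhds hz)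

/-- RH-FREE. **`φ₁(σ + is) → 0` as `|s| → ∞`** (`σ > −1`; dominated convergence for sums).
[cite: ConnesConsani2021QuasiInner, Prop 4.5 proof (arXiv chunk p0013:L36–L37)] -/
theorem tendsto_archProductPolarPart_vertical {p : ℕ} (hp : 2 ≤ p) {σ : ℝ} (hσ : -1 < σ) :
    Tendsto (fun s : ℝ => archProductPolarPart p ((σ : ℂ) + s * I)) (cocompact ℝ) (𝓝 0) := by
  have hre : ∀ s : ℝ, -1 < ((σ : ℂ) + s * I).re := fun s => by simpa using hσ
  have h := tendsto_tsum_of_dominated_convergence (𝓕 := cocompact ℝ)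
    (f := fun (s : ℝ) (n : ℕ) => (thm44Coeff p (n + 1) : ℂ) / (((σ : ℂ) + s * I) + 2 * ((n : ℂ) + 1)))
    (g := fun _ => (0 : ℂ)) (bound := fun n => 4 * Real.sqrt π * (π ^ 2) ^ (n + 1) / (n + 1) !)
    summable_thm44_majorant ?_ (Filter.Eventually.of_forall fun s n => norm_archProductPolarTerm_le hp (hre s) n)
  · simpa [archProductPolarPart] using h
  · intro n
    -- each term tends to `0`: the denominator tends to `∞` in norm
    have hden : Tendsto (fun s : ℝ => ‖((σ : ℂ) + s * I) + 2 * ((n : ℂ) + 1)‖) (cocompact ℝ) atTop := by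
      refine tendsto_atTop_mono (fun s => ?_) (tendsto_norm_cocompact_atTop (E := ℝ))
      have h := abs_im_le_norm (((σ : ℂ) + s * I) + 2 * ((n : ℂ) + 1))
      simpa [Real.norm_eq_abs] using h
    have h0 : Tendsto (fun s : ℝ => ‖(thm44Coeff p (n + 1) : ℂ)‖ * ‖((σ : ℂ) + s * I) + 2 * ((n : ℂ) + 1)‖⁻¹)
        (cocompact ℝ) (𝓝 0) := by
      have h := hden.inv_tendsto_atTop.const_mul ‖(thm44Coeff p (n + 1) : ℂ)‖
      rw [mul_zero] at h
      exact h
    refine squeeze_zero_norm (fun s => ?_) h0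
    rw [norm_div, div_eq_mul_inv]


/-- RH-FREE. **`φ₁∘ψ ∈ C(S¹)`** (with value `0` at `v = 1`; `φ₁` in the printed second form — the true polar part is
`continuous_circlePullback_archProductPolarPartRes`). [cite: ConnesConsani2021QuasiInner, Prop 4.5 proof (arXiv chunk p0013:L36–L37)] -/
theorem continuous_circlePullback_archProductPolarPart {p : ℕ} (hp : 2 ≤ p) :
    Continuous (circlePullback (archProductPolarPart p)) :=
  continuous_circlePullback (fun z hz => continuousAt_archProductPolarPart hp (by rw [hz]; norm_num))
    (tendsto_archProductPolarPart_vertical hp (by norm_num))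

/-! ## 10. The continuous part `(φ + φ₁ + φ₂)∘ψ ∈ C(S¹)` of Prop. 4.5 -/

/-- RH-FREE. **«The sum of the polar parts `πρ^{p,∞} := φ + φ₁ + φ₂` is in `C(S¹)` after composition with
`ψ`»** — for a prime `p` and ANY coefficients `a, b` of the double-pole part `φ₂(z) = a z⁻² + b z⁻¹` (in print
`a = 2(p−1)/(p log p)`, `b = ((p−3)log p − (p−1)(γ + 2 log π − Γ′/Γ(½)))/(p log p)`, p0013:L37), the `1`-periodic
function `x ↦ (φ + φ₁ + φ₂)(ψ(e^{2πix}))` (value `0` at `e^{2πix} = 1`) is continuous, with `φ₁` in the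
PRINTED second form (`archProductPolarPart`, see the erratum there); the version with the actual polar part
`archProductPolarPartRes` — the candidate `c` of the boundary-value form of `QuasiInner.prop_4_5` — is
`continuous_circlePullback_polarPartsRes` below.  The `H^∞(𝒰)` half is NOT in this file.
[cite: ConnesConsani2021QuasiInner, Prop 4.5 proof (arXiv chunk p0013:L38–L45)] -/
theorem continuous_circlePullback_polarParts {p : ℕ} (hp : p.Prime) (a b : ℂ) :
    Continuous (circlePullback fun z =>
      primePolarPart p z + archProductPolarPart p z + (a * z⁻¹ ^ 2 + b * z⁻¹ ^ 1)) := by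
  have hp1 : 1 < p := hp.one_lt
  have hp2 : 2 ≤ p := hp.two_le
  refine continuous_circlePullback (fun z hz => ?_) ?_
  · have hz0 : z ≠ 0 := fun h => by rw [h, Complex.zero_re] at hz; norm_num at hz
    have h1 : ContinuousAt (primePolarPart p) z := continuousAt_primePolarPart hp1 (by rw [hz]; norm_num)
    have h2 : ContinuousAt (archProductPolarPart p) z :=
      continuousAt_archProductPolarPart hp2 (by rw [hz]; norm_num)
    have h3 : ContinuousAt (fun z : ℂ => a * z⁻¹ ^ 2 + b * z⁻¹ ^ 1) z :=
      (continuousAt_const.mul ((continuousAt_id.inv₀ hz0).pow 2)).add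
        (continuousAt_const.mul ((continuousAt_id.inv₀ hz0).pow 1))
    exact (h1.add h2).add h3
  · have h := ((tendsto_primePolarPart_vertical hp1 (σ := 1 / 2) (by norm_num)).add
      (tendsto_archProductPolarPart_vertical hp2 (σ := 1 / 2) (by norm_num))).add
      (((tendsto_inv_pow_vertical (k := 2) (by norm_num)).const_mul a).add
        ((tendsto_inv_pow_vertical (k := 1) le_rfl).const_mul b))
    simpa using h

/-- RH-FREE. … and `1`-periodic. [cite: ConnesConsani2021QuasiInner, Prop 4.5 proof (arXiv chunk p0013:L38)] -/
theorem periodic_circlePullback_polarParts (p : ℕ) (a b : ℂ) :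
    Function.Periodic (circlePullback fun z =>
      primePolarPart p z + archProductPolarPart p z + (a * z⁻¹ ^ 2 + b * z⁻¹ ^ 1)) 1 :=
  circlePullback_periodic _


/-! ## 11. Uniform bounds of `φ` on the contours `C_{R,m}` -/

/-- RH-FREE. **`φ` is uniformly bounded on `{|Re z| ≥ 1}`** (the vertical sides of the contours `C_{R,m}`):
Hölder with exponents `3, 3/2` (`x_n = |ρ_∞(2πin/log p)|`, `y_n = |z − 2πin/log p|⁻¹`) and the uniform
shifted-lattice bound, as in print («To obtain a uniform bound for `|φ(z)|` on `C_{R,m}` one uses Hölder's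
inequality … `p = 3`, `q = 3/2` … `Σ_n |z − 2πin/log p|^{−q} ≤ C`»).
[cite: ConnesConsani2021QuasiInner, Prop 4.5 proof (arXiv chunk p0013:L39–L43)] -/
theorem norm_primePolarPart_le_of_one_le_abs_re {p : ℕ} (hp : 1 < p) :
    ∃ C : ℝ, ∀ z : ℂ, 1 ≤ |z.re| → ‖primePolarPart p z‖ ≤ C := by
  have hlog : 0 < Real.log p := Real.log_pos (by exact_mod_cast hp)
  set b : ℝ := 2 * π / Real.log p with hbdef
  have hb : 0 < b := by positivity
  set K : ℝ := ((2 / (1 : ℝ)) ^ (3 / 2 : ℝ) * ((min 1 b) ^ (-(3 / 2 : ℝ)) *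
    ∑' k : ℤ, (max 1 |(k : ℝ)|) ^ (-(3 / 2 : ℝ)))) ^ (2 / 3 : ℝ) with hK
  set T : ℝ := (∑' n : ℤ, dXtail p 0 n ^ (3 : ℝ)) ^ (1 / 3 : ℝ) with hT
  refine ⟨‖(1 - (p : ℂ)⁻¹) / Real.log p‖ * (T * K), fun z hz => ?_⟩
  have hσ : z.re ≠ 0 := fun h => by rw [h, abs_zero] at hz; linarith
  have hmin : min |z.re| 1 = 1 := min_eq_right hz
  have hzre : ((z.re : ℂ) + z.im * I) = z := Complex.re_add_im z
  have hle := tsum_norm_primePolarTerm_le hp hσ z.im 0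
  rw [hmin, hzre] at hle
  have hhead : ∑ n ∈ Finset.Icc (-((0 : ℕ) : ℤ)) ((0 : ℕ) : ℤ), dXhead p 0 n * dY 1 (2 * π / Real.log p) z.im n = 0 := by
    simp [dXhead, dX]
  rw [hhead, zero_add] at hle
  calc ‖primePolarPart p z‖ ≤ ‖(1 - (p : ℂ)⁻¹) / Real.log p‖ * ∑' n : ℤ, ‖primePolarTerm p z n‖ := by
        rw [primePolarPart, norm_mul]
        exact mul_le_mul_of_nonneg_left (norm_tsum_le_tsum_norm (summable_primePolarTerm hp hσ).norm)
          (norm_nonneg _)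
    _ ≤ ‖(1 - (p : ℂ)⁻¹) / Real.log p‖ * (T * K) := mul_le_mul_of_nonneg_left hle (norm_nonneg _)

/-- RH-FREE. `|2k + 1| ≥ max(1, |k|)` for integers. [folklore] -/
private theorem max_one_abs_le_abs_two_mul_add_one (k : ℤ) : max 1 |(k : ℝ)| ≤ |2 * (k : ℝ) + 1| := by
  rcases le_or_gt 0 k with hk | hk
  · have hk' : (0 : ℝ) ≤ k := by exact_mod_cast hk
    rw [abs_of_nonneg hk', abs_of_nonneg (by linarith)]
    refine max_le (by linarith) (by linarith)
  · have hk' : (k : ℝ) ≤ -1 := by exact_mod_cast (Int.le_sub_one_of_lt hk)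
    rw [abs_of_neg (by linarith : (k : ℝ) < 0), abs_of_neg (by linarith : 2 * (k : ℝ) + 1 < 0)]
    refine max_le (by linarith) (by linarith)

/-- RH-FREE. **`φ` is uniformly bounded on the horizontal lines `Im z = (2m+1)π/log p`, `m ∈ ℤ`** (the horizontal
sides of the contours `C_{R,m}`, `R = (2m+1)π/log p`, half-way between the poles): there
`|z − 2πin/log p| ≥ (π/log p)|2(m−n)+1|` and `Σ_n |2(m−n)+1|^{-3/2}` does not depend on `m`; Hölder `3, 3/2`.
[cite: ConnesConsani2021QuasiInner, Prop 4.5 proof (arXiv chunk p0013:L39–L43)] -/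
theorem norm_primePolarPart_le_of_im_half_lattice {p : ℕ} (hp : 1 < p) :
    ∃ C : ℝ, ∀ (z : ℂ) (m : ℤ), z.im = (2 * m + 1) * π / Real.log p → ‖primePolarPart p z‖ ≤ C := by
  have hlog : 0 < Real.log p := Real.log_pos (by exact_mod_cast hp)
  set b : ℝ := 2 * π / Real.log p with hbdef
  have hb : 0 < b := by positivity
  set C₀ : ℝ := ∑' k : ℤ, (max 1 |(k : ℝ)|) ^ (-(3 / 2 : ℝ)) with hC₀
  set T : ℝ := (∑' n : ℤ, dX p n ^ (3 : ℝ)) ^ (1 / 3 : ℝ) with hT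
  set K : ℝ := ((2 / b) ^ (3 / 2 : ℝ) * C₀) ^ (2 / 3 : ℝ) with hK
  refine ⟨‖(1 - (p : ℂ)⁻¹) / Real.log p‖ * (T * K), fun z m hz => ?_⟩
  -- separation from the poles on the half-lattice line
  have hsep : ∀ n : ℤ, b / 2 * max 1 |((m - n : ℤ) : ℝ)| ≤ ‖z - primePole p n‖ := fun n => by
    have h1 := abs_im_sub_le_norm_sub_primePole p z n
    rw [hz] at h1
    have e : (2 * (m : ℝ) + 1) * π / Real.log p - 2 * π * n / Real.log p = b / 2 * (2 * ((m - n : ℤ) : ℝ) + 1) := by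
      rw [hbdef]; push_cast; ring
    rw [e, abs_mul, abs_of_pos (by positivity : (0 : ℝ) < b / 2)] at h1
    exact le_trans (mul_le_mul_of_nonneg_left (max_one_abs_le_abs_two_mul_add_one (m - n)) (by positivity)) h1
  -- the dominating `W n = (2/b)·max(1,|m−n|)⁻¹`
  set W : ℤ → ℝ := fun n => 2 / b * (max 1 |((m - n : ℤ) : ℝ)|)⁻¹ with hWdef
  have hW0 : ∀ n, 0 ≤ W n := fun n => by positivity
  have hmax0 : ∀ n : ℤ, (0 : ℝ) < max 1 |((m - n : ℤ) : ℝ)| := fun n => lt_of_lt_of_le one_pos (le_max_left _ _)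
  have hterm : ∀ n : ℤ, ‖primePolarTerm p z n‖ ≤ dX p n * W n := fun n => by
    by_cases hn : n = 0
    · subst hn; rw [primePolarTerm_zero, norm_zero]; exact mul_nonneg (dX_nonneg p 0) (hW0 0)
    have hX : dX p n = rhoArchPoleConst p * |(n : ℝ)| ^ (-(1 / 2 : ℝ)) := by simp [dX, hn]
    have hden : 0 < ‖z - primePole p n‖ := lt_of_lt_of_le (mul_pos (by positivity) (hmax0 n)) (hsep n)
    rw [primePolarTerm_of_ne_zero p _ hn, norm_div, div_le_iff₀ hden, hX]
    have hWsep : 1 ≤ W n * ‖z - primePole p n‖ := by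
      calc (1 : ℝ) = W n * (b / 2 * max 1 |((m - n : ℤ) : ℝ)|) := by
            rw [hWdef]; field_simp
        _ ≤ W n * ‖z - primePole p n‖ := mul_le_mul_of_nonneg_left (hsep n) (hW0 n)
    calc ‖rhoArch (primePole p n)‖ ≤ rhoArchPoleConst p * |(n : ℝ)| ^ (-(1 / 2 : ℝ)) :=
          norm_rhoArch_primePole_le hp hn
      _ = rhoArchPoleConst p * |(n : ℝ)| ^ (-(1 / 2 : ℝ)) * 1 := (mul_one _).symm
      _ ≤ rhoArchPoleConst p * |(n : ℝ)| ^ (-(1 / 2 : ℝ)) * (W n * ‖z - primePole p n‖) := by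
          have h0 : 0 ≤ rhoArchPoleConst p * |(n : ℝ)| ^ (-(1 / 2 : ℝ)) := by rw [← hX]; exact dX_nonneg p n
          exact mul_le_mul_of_nonneg_left hWsep h0
      _ = _ := by ring
  -- `Σ W^{3/2} = (2/b)^{3/2} C₀` (shift invariance)
  have hW32 : ∀ n : ℤ, W n ^ (3 / 2 : ℝ) = (2 / b) ^ (3 / 2 : ℝ) * (max 1 |((m - n : ℤ) : ℝ)|) ^ (-(3 / 2 : ℝ)) := by
    intro n
    rw [hWdef]
    simp only
    rw [Real.mul_rpow (by positivity) (by positivity), Real.inv_rpow (hmax0 n).le, Real.rpow_neg (hmax0 n).le]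
  have hWsum : Summable (fun n : ℤ => W n ^ (3 / 2 : ℝ)) ∧
      ∑' n : ℤ, W n ^ (3 / 2 : ℝ) = (2 / b) ^ (3 / 2 : ℝ) * C₀ := by
    simp_rw [hW32]
    have e : (fun n : ℤ => (max 1 |((m - n : ℤ) : ℝ)|) ^ (-(3 / 2 : ℝ))) =
        (fun k : ℤ => (max 1 |(k : ℝ)|) ^ (-(3 / 2 : ℝ))) ∘ (Equiv.subLeft m) := by
      funext n; simp [Equiv.subLeft]
    have hs : Summable (fun n : ℤ => (max 1 |((m - n : ℤ) : ℝ)|) ^ (-(3 / 2 : ℝ))) := by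
      rw [e]; exact (Equiv.subLeft m).summable_iff.2 summable_max_one_abs_rpow
    refine ⟨hs.mul_left _, ?_⟩
    rw [tsum_mul_left]
    congr 1
    rw [e]
    exact (Equiv.subLeft m).tsum_eq (fun k : ℤ => (max 1 |(k : ℝ)|) ^ (-(3 / 2 : ℝ)))
  -- Hölder
  have hpq : (3 : ℝ).HolderConjugate (3 / 2) := Real.holderConjugate_iff.2 ⟨by norm_num, by norm_num⟩
  obtain ⟨hXW, hholder⟩ := Real.summable_and_inner_le_Lp_mul_Lq_tsum_of_nonneg hpq (dX_nonneg p) hW0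
    (summable_dX_rpow_three p) hWsum.1
  rw [hWsum.2, show (1 / (3 / 2 : ℝ)) = (2 / 3 : ℝ) by norm_num] at hholder
  -- summability of the terms (domination by `dX·W`; `Re z` may vanish here)
  have hsum : Summable (fun n : ℤ => ‖primePolarTerm p z n‖) :=
    Summable.of_nonneg_of_le (fun n => norm_nonneg _) hterm hXW
  calc ‖primePolarPart p z‖ ≤ ‖(1 - (p : ℂ)⁻¹) / Real.log p‖ * ∑' n : ℤ, ‖primePolarTerm p z n‖ := by
        rw [primePolarPart, norm_mul]
        exact mul_le_mul_of_nonneg_left (norm_tsum_le_tsum_norm hsum) (norm_nonneg _)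
    _ ≤ ‖(1 - (p : ℂ)⁻¹) / Real.log p‖ * ∑' n : ℤ, dX p n * W n :=
        mul_le_mul_of_nonneg_left (Summable.tsum_le_tsum hterm hsum hXW) (norm_nonneg _)
    _ ≤ ‖(1 - (p : ℂ)⁻¹) / Real.log p‖ * (T * K) := mul_le_mul_of_nonneg_left hholder (norm_nonneg _)


/-- RH-FREE. Separation from the poles in the form used by Hölder: if `|z − 2πin/log p| ≥ r₀` then
`|z − 2πin/log p| ≥ (min(r₀,1)/2)(1 + |Im z − 2πn/log p|)`. [folklore] -/
private theorem norm_sub_primePole_ge_of_le (p : ℕ) {r₀ : ℝ} {z : ℂ} {n : ℤ} (h : r₀ ≤ ‖z - primePole p n‖) :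
    min r₀ 1 / 2 * (1 + |z.im - 2 * π * n / Real.log p|) ≤ ‖z - primePole p n‖ := by
  set m := min r₀ 1 with hmdef
  have hm1 : m ≤ 1 := min_le_right _ _
  have h1 : m ≤ ‖z - primePole p n‖ := (min_le_left _ _).trans h
  have h2 : |z.im - 2 * π * n / Real.log p| ≤ ‖z - primePole p n‖ := abs_im_sub_le_norm_sub_primePole p z n
  have h3 : m * |z.im - 2 * π * n / Real.log p| ≤ ‖z - primePole p n‖ :=
    le_trans (mul_le_of_le_one_left (abs_nonneg _) hm1) h2
  have e : m / 2 * (1 + |z.im - 2 * π * n / Real.log p|) = (m + m * |z.im - 2 * π * n / Real.log p|) / 2 := by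
    ring
  rw [e]
  linarith

/-- RH-FREE. **`φ` is bounded off the `r₀`-neighbourhoods of the poles of `ρ_p`, uniformly in `z ∈ ℂ`**:
`∃ C ∀ z, (∀ n ≠ 0, |z − 2πin/log p| ≥ r₀) ⇒ |φ(z)| ≤ C` — Hölder `3, 3/2` with the uniform shifted-lattice bound
(«a uniform bound independent of `m` of the form `Σ_n |z − 2πin/log p|^{−q} ≤ C`»); contains the bounds on the
contours `C_{R,m}` (§11) and is the form used for the maximum principle around the poles.
[cite: ConnesConsani2021QuasiInner, Prop 4.5 proof (arXiv chunk p0013:L39–L43)] -/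
theorem norm_primePolarPart_le_of_forall_le_norm_sub {p : ℕ} (hp : 1 < p) {r₀ : ℝ} (hr : 0 < r₀) :
    ∃ C : ℝ, ∀ z : ℂ, (∀ n : ℤ, n ≠ 0 → r₀ ≤ ‖z - primePole p n‖) → ‖primePolarPart p z‖ ≤ C := by
  have hlog : 0 < Real.log p := Real.log_pos (by exact_mod_cast hp)
  set b : ℝ := 2 * π / Real.log p with hbdef
  have hb : 0 < b := by positivity
  set m : ℝ := min r₀ 1 with hmdef
  have hm : 0 < m := lt_min hr one_pos
  set K : ℝ := ((2 / m) ^ (3 / 2 : ℝ) * ((min 1 b) ^ (-(3 / 2 : ℝ)) *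
    ∑' k : ℤ, (max 1 |(k : ℝ)|) ^ (-(3 / 2 : ℝ)))) ^ (2 / 3 : ℝ) with hK
  set T : ℝ := (∑' n : ℤ, dXtail p 0 n ^ (3 : ℝ)) ^ (1 / 3 : ℝ) with hT
  refine ⟨‖(1 - (p : ℂ)⁻¹) / Real.log p‖ * (T * K), fun z hz => ?_⟩
  have htail0 : ∀ n : ℤ, dXtail p 0 n = dX p n := fun n => by
    unfold dXtail dX
    by_cases hn : n = 0
    · subst hn; simp
    · rw [if_pos (by simpa using hn)]
  -- termwise domination by `dX · dY m b (Im z)`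
  have hterm : ∀ n : ℤ, ‖primePolarTerm p z n‖ ≤ dXtail p 0 n * dY m b z.im n := fun n => by
    rw [htail0]
    by_cases hn : n = 0
    · subst hn; rw [primePolarTerm_zero, norm_zero]; exact mul_nonneg (dX_nonneg p 0) (dY_nonneg hm _ _ _)
    have hX : dX p n = rhoArchPoleConst p * |(n : ℝ)| ^ (-(1 / 2 : ℝ)) := by simp [dX, hn]
    set u : ℝ := |z.im - b * n| with hu
    have hu' : |z.im - 2 * π * n / Real.log p| = u := by rw [hu, hbdef]; ring_nf
    have hsep : m / 2 * (1 + u) ≤ ‖z - primePole p n‖ := by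
      rw [← hu']; exact norm_sub_primePole_ge_of_le p (hz n hn)
    have hden : 0 < ‖z - primePole p n‖ := lt_of_lt_of_le (by positivity) hsep
    rw [primePolarTerm_of_ne_zero p _ hn, norm_div, div_le_iff₀ hden, hX]
    have hY : dY m b z.im n * (m / 2 * (1 + u)) = 1 := by
      rw [dY, ← hu]
      have h1 : (1 + u) ≠ 0 := by positivity
      field_simp
    calc ‖rhoArch (primePole p n)‖ ≤ rhoArchPoleConst p * |(n : ℝ)| ^ (-(1 / 2 : ℝ)) :=
          norm_rhoArch_primePole_le hp hn
      _ = rhoArchPoleConst p * |(n : ℝ)| ^ (-(1 / 2 : ℝ)) * (dY m b z.im n * (m / 2 * (1 + u))) := by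
          rw [hY, mul_one]
      _ ≤ rhoArchPoleConst p * |(n : ℝ)| ^ (-(1 / 2 : ℝ)) * (dY m b z.im n * ‖z - primePole p n‖) := by
          have h0 : 0 ≤ rhoArchPoleConst p * |(n : ℝ)| ^ (-(1 / 2 : ℝ)) := by rw [← hX]; exact dX_nonneg p n
          exact mul_le_mul_of_nonneg_left (mul_le_mul_of_nonneg_left hsep (dY_nonneg hm _ _ _)) h0
      _ = _ := by ring
  obtain ⟨hXY, hholder⟩ := tsum_dXtail_mul_dY_le (p := p) hm hb z.im 0
  have hsum : Summable (fun n : ℤ => ‖primePolarTerm p z n‖) :=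
    Summable.of_nonneg_of_le (fun n => norm_nonneg _) hterm hXY
  calc ‖primePolarPart p z‖ ≤ ‖(1 - (p : ℂ)⁻¹) / Real.log p‖ * ∑' n : ℤ, ‖primePolarTerm p z n‖ := by
        rw [primePolarPart, norm_mul]
        exact mul_le_mul_of_nonneg_left (norm_tsum_le_tsum_norm hsum) (norm_nonneg _)
    _ ≤ ‖(1 - (p : ℂ)⁻¹) / Real.log p‖ * ∑' n : ℤ, dXtail p 0 n * dY m b z.im n :=
        mul_le_mul_of_nonneg_left (Summable.tsum_le_tsum hterm hsum hXY) (norm_nonneg _)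
    _ ≤ ‖(1 - (p : ℂ)⁻¹) / Real.log p‖ * (T * K) := mul_le_mul_of_nonneg_left hholder (norm_nonneg _)


/-- RH-FREE. **`φ₁` is bounded off the `r₀`-neighbourhoods of its poles `−2n` (`n ≥ 1`)**, uniformly on `ℂ`
(termwise `|c_n(p)|/r₀`, summable coefficients), `p ≥ 2`.
[cite: ConnesConsani2021QuasiInner, Prop 4.5 proof (arXiv chunk p0013:L38–L39)] -/
theorem norm_archProductPolarPart_le_of_forall_le_norm_add {p : ℕ} (hp : 2 ≤ p) {r₀ : ℝ} (hr : 0 < r₀) :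
    ∃ C : ℝ, ∀ z : ℂ, (∀ n : ℕ, r₀ ≤ ‖z + 2 * ((n : ℂ) + 1)‖) → ‖archProductPolarPart p z‖ ≤ C := by
  refine ⟨r₀⁻¹ * ∑' n : ℕ, 4 * Real.sqrt π * (π ^ 2) ^ (n + 1) / (n + 1) !, fun z hz => ?_⟩
  have hle : ∀ n : ℕ, ‖(thm44Coeff p (n + 1) : ℂ) / (z + 2 * ((n : ℂ) + 1))‖ ≤
      r₀⁻¹ * (4 * Real.sqrt π * (π ^ 2) ^ (n + 1) / (n + 1) !) := fun n => by
    have hd : 0 < ‖z + 2 * ((n : ℂ) + 1)‖ := lt_of_lt_of_le hr (hz n)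
    rw [norm_div, Complex.norm_real, Real.norm_eq_abs, div_eq_mul_inv, mul_comm]
    refine mul_le_mul ?_ ?_ (abs_nonneg _) (by positivity)
    · exact (inv_le_inv₀ hd hr).2 (hz n)
    · have := abs_thm44Coeff_le hp (by omega : 1 ≤ n + 1)
      simpa using this
  have hs : Summable fun n : ℕ => r₀⁻¹ * (4 * Real.sqrt π * (π ^ 2) ^ (n + 1) / (n + 1) !) :=
    summable_thm44_majorant.mul_left _
  calc ‖archProductPolarPart p z‖ ≤ ∑' n : ℕ, ‖(thm44Coeff p (n + 1) : ℂ) / (z + 2 * ((n : ℂ) + 1))‖ :=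
        norm_tsum_le_tsum_norm (Summable.of_nonneg_of_le (fun n => norm_nonneg _) hle hs)
    _ ≤ ∑' n : ℕ, r₀⁻¹ * (4 * Real.sqrt π * (π ^ 2) ^ (n + 1) / (n + 1) !) :=
        Summable.tsum_le_tsum hle (Summable.of_nonneg_of_le (fun n => norm_nonneg _) hle hs) hs
    _ = r₀⁻¹ * ∑' n : ℕ, 4 * Real.sqrt π * (π ^ 2) ^ (n + 1) / (n + 1) ! := tsum_mul_left


/-- RH-FREE. The poles form a lattice: `2πi(n+k)/log p = 2πin/log p + k·(2πi/log p)`. [folklore] -/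
private theorem primePole_add (p : ℕ) (n k : ℤ) :
    primePole p (n + k) = primePole p n + (k : ℂ) * (2 * π * I / Real.log p) := by
  unfold primePole; push_cast; ring

/-- RH-FREE. **`ρ_p` is bounded on `{Re z ≤ 1}` off the `r₀`-neighbourhoods of its poles** (`p` prime):
for `Re z ≤ −1` by t17's `norm_rhoPrime_le_of_re_le`; on the strip `|Re z| ≤ 1` by the periodicity
`ρ_p(z + 2πi/log p) = ρ_p(z)` (Lemma 3.1 (i)) and compactness of one period with the pole neighbourhoods removed
(`ρ_p` is analytic off its poles, Lemma 3.1 (ii)).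
[cite: ConnesConsani2021QuasiInner, Lemma 3.1 (i)–(ii) (arXiv chunk p0008:L11–L17)] -/
theorem exists_norm_rhoPrime_le_of_forall_le_norm_sub {p : ℕ} (hp : p.Prime) {r₀ : ℝ} (hr : 0 < r₀) :
    ∃ C : ℝ, ∀ z : ℂ, z.re ≤ 1 → (∀ n : ℤ, r₀ ≤ ‖z - primePole p n‖) → ‖rhoPrime p z‖ ≤ C := by
  have hp1 : 1 < p := hp.one_lt
  have hlog : 0 < Real.log p := Real.log_pos (by exact_mod_cast hp1)
  set b : ℝ := 2 * π / Real.log p with hbdef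
  have hb : 0 < b := by positivity
  set c : ℂ := 2 * π * I / Real.log p with hcdef
  -- the compact set: one period of the strip, pole neighbourhoods removed
  set K : Set ℂ := {w : ℂ | |w.re| ≤ 1 ∧ |w.im| ≤ b} ∩ ⋂ n : ℤ, {w : ℂ | r₀ ≤ ‖w - primePole p n‖} with hKdef
  have hKc : IsClosed K := by
    refine IsClosed.inter (IsClosed.inter ?_ ?_) (isClosed_iInter fun n => ?_)
    · exact isClosed_le (continuous_abs.comp Complex.continuous_re) continuous_const
    · exact isClosed_le (continuous_abs.comp Complex.continuous_im) continuous_const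
    · exact isClosed_le continuous_const (continuous_id.sub continuous_const).norm
  have hKb : Bornology.IsBounded K := by
    refine (Metric.isBounded_closedBall (x := (0 : ℂ)) (r := 1 + b)).subset fun w hw => ?_
    rw [Metric.mem_closedBall, dist_zero_right]
    have h := Complex.norm_le_abs_re_add_abs_im w
    linarith [hw.1.1, hw.1.2]
  have hK : IsCompact K := Metric.isCompact_of_isClosed_isBounded hKc hKb
  have hcont : ContinuousOn (rhoPrime p) K := by
    intro w hw
    have hw2 : ∀ n : ℤ, r₀ ≤ ‖w - primePole p n‖ := fun n => by
      have := Set.mem_iInter.1 hw.2 n; exact this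
    have hne : ∀ k : ℤ, w ≠ 2 * π * I * k / Real.log p := fun k h => by
      have h2 := hw2 k
      rw [show primePole p k = 2 * π * I * k / Real.log p from rfl, ← h, sub_self, norm_zero] at h2
      linarith
    exact ((lemma_3_1_ii_holds p hp).2.1 w hne).continuousAt.continuousWithinAt
  obtain ⟨C₂, hC₂⟩ := hK.exists_bound_of_continuousOn hcont
  set C₁ : ℝ := (1 + (p : ℝ)⁻¹) / ((p : ℝ) ^ (1 : ℝ) - 1) with hC₁
  refine ⟨max C₁ C₂, fun z hz hsep => ?_⟩
  by_cases hre : z.re ≤ -1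
  · exact (norm_rhoPrime_le_of_re_le hp1 one_pos hre).trans (le_max_left _ _)
  · -- reduce modulo the period into `K`
    set k : ℤ := round (z.im / b) with hk
    set z' : ℂ := z - (k : ℂ) * c with hz'
    have hper : rhoPrime p z' = rhoPrime p z := by
      rw [hz', hcdef]; exact (rhoPrime_periodic hp1).sub_int_mul_eq k
    have hz'eq : z' = z - ((k * b : ℝ) : ℂ) * I := by
      rw [hz', hcdef, hbdef]; push_cast; ring
    have hre' : z'.re = z.re := by
      rw [hz'eq, sub_re, mul_re, ofReal_re, ofReal_im, I_re, I_im]; ring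
    have him' : z'.im = z.im - k * b := by
      rw [hz'eq, sub_im, mul_im, ofReal_re, ofReal_im, I_re, I_im]; ring
    have hzK : z' ∈ K := by
      refine ⟨⟨?_, ?_⟩, Set.mem_iInter.2 fun n => ?_⟩
      · rw [hre', abs_le]; constructor <;> linarith [not_le.1 hre]
      · rw [him']
        have h1 : |z.im / b - k| ≤ 1 / 2 := by rw [hk]; exact abs_sub_round _
        have h2 : z.im - k * b = b * (z.im / b - k) := by field_simp
        rw [h2, abs_mul, abs_of_pos hb]
        nlinarith
      · show r₀ ≤ ‖z' - primePole p n‖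
        have e : z' - primePole p n = z - primePole p (n + k) := by
          rw [hz', primePole_add, hcdef]; ring
        rw [e]; exact hsep (n + k)
    calc ‖rhoPrime p z‖ = ‖rhoPrime p z'‖ := by rw [hper]
      _ ≤ C₂ := hC₂ z' hzK
      _ ≤ max C₁ C₂ := le_max_right _ _


/-! ## 12. Removable singularities of `ρ_∞ρ_p − φ` at the poles of `ρ_p` -/

/-- RH-FREE. `ρ_p` is meromorphic everywhere (quotient of entire functions). [folklore] -/
private theorem meromorphicAt_rhoPrime {p : ℕ} (hp : 1 < p) (z : ℂ) : MeromorphicAt (rhoPrime p) z := by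
  have hp0 : (p : ℂ) ≠ 0 := Nat.cast_ne_zero.2 (by omega)
  have hN : Differentiable ℂ (fun w : ℂ => 1 - (p : ℂ) ^ (w - 1)) :=
    (differentiable_const _).sub ((differentiable_id.sub (differentiable_const _)).const_cpow (Or.inl hp0))
  have hD : Differentiable ℂ (fun w : ℂ => 1 - (p : ℂ) ^ (-w)) :=
    (differentiable_const _).sub (differentiable_id.neg.const_cpow (Or.inl hp0))
  have h : rhoPrime p = fun w => (fun w : ℂ => 1 - (p : ℂ) ^ (w - 1)) w / (fun w : ℂ => 1 - (p : ℂ) ^ (-w)) w := by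
    funext w; rfl
  rw [h]
  exact ((hN.analyticAt z).meromorphicAt).div ((hD.analyticAt z).meromorphicAt)

/-- RH-FREE. `ρ_∞` is analytic at every point off the real axis (its poles `−2n` are real). [folklore] -/
private theorem analyticAt_rhoArch_of_im_ne_zero {z : ℂ} (hz : z.im ≠ 0) : AnalyticAt ℂ rhoArch z := by
  rw [Complex.analyticAt_iff_eventually_differentiableAt]
  have hopen : IsOpen {w : ℂ | w.im ≠ 0} := isOpen_ne_fun Complex.continuous_im continuous_const
  filter_upwards [hopen.mem_nhds (show z ∈ {w : ℂ | w.im ≠ 0} from hz)] with w hw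
  refine differentiableAt_rhoArch (fun h0 => ?_)
  obtain ⟨k, hk⟩ := Complex.Gammaℝ_eq_zero_iff.1 h0
  have h2 : w.im = 0 := by
    have := congrArg Complex.im hk
    simpa using this
  exact hw h2

/-- RH-FREE. **Removable singularity of `ρ_∞ρ_p − φ`'s `n`-th polar term at `2πin/log p` (`n ≠ 0`)**: near the
simple pole `z_n = 2πin/log p` of `ρ_p` (residue `(1 − p⁻¹)/log p`, Lemma 3.1 (ii) / §3), the function
`ρ_∞(z)ρ_p(z) − ((1 − p⁻¹)/log p)·ρ_∞(z_n)/(z − z_n)` agrees on a punctured neighbourhood with a function analytic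
at `z_n` («the residues are, for the simple poles, multiplied by the value of the other factor at the point»).
[cite: ConnesConsani2021QuasiInner, Thm 4.4 proof (arXiv chunk p0012:L7); Prop 4.5 proof (p0013:L9); Lemma 3.1 (ii) (p0008:L11–L17)] -/
theorem exists_analyticAt_rhoArch_mul_rhoPrime_sub_polar {p : ℕ} (hp : p.Prime) {n : ℤ} (hn : n ≠ 0) :
    ∃ g : ℂ → ℂ, AnalyticAt ℂ g (primePole p n) ∧
      ∀ᶠ z in 𝓝[≠] (primePole p n),
        rhoArch z * rhoPrime p z -
          (1 - (p : ℂ)⁻¹) / Real.log p * rhoArch (primePole p n) / (z - primePole p n) = g z := by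
  have hp1 : 1 < p := hp.one_lt
  have hlog : 0 < Real.log p := Real.log_pos (by exact_mod_cast hp1)
  set zn : ℂ := primePole p n with hzn
  set R : ℂ := (1 - (p : ℂ)⁻¹) / Real.log p with hR
  -- Lemma 3.1 (ii): order `−1` at `zn`
  have horder : meromorphicOrderAt (rhoPrime p) zn = (-1 : ℤ) := by
    have h := (lemma_3_1_ii_holds p hp).1 n
    rw [hzn]; exact h
  obtain ⟨g₀, hg₀, hg₀ne, hev⟩ := (meromorphicOrderAt_eq_int_iff (meromorphicAt_rhoPrime hp1 zn)).1 horder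
  -- the value `g₀ zn` is the residue `R`
  have hval : g₀ zn = R := by
    have h1 : Tendsto (fun z : ℂ => (z - zn) * rhoPrime p z) (𝓝[≠] zn) (𝓝 R) := by
      have h := tendsto_sub_mul_rhoPrime_pole hp1 n
      rw [hzn]; exact h
    have h2 : Tendsto g₀ (𝓝[≠] zn) (𝓝 (g₀ zn)) :=
      hg₀.continuousAt.tendsto.mono_left nhdsWithin_le_nhds
    have h3 : ∀ᶠ z in 𝓝[≠] zn, (z - zn) * rhoPrime p z = g₀ z := by
      filter_upwards [hev, self_mem_nhdsWithin] with z hz hz'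
      rw [hz, zpow_neg, zpow_one, smul_eq_mul, ← mul_assoc, mul_inv_cancel₀ (sub_ne_zero.2 hz'), one_mul]
    exact (tendsto_nhds_unique (h1.congr' h3) h2).symm
  -- `ρ_∞` is analytic at `zn` (`Im zn = 2πn/log p ≠ 0`)
  have him : zn.im ≠ 0 := by
    rw [hzn, primePole_im]
    have : (n : ℝ) ≠ 0 := by exact_mod_cast hn
    positivity
  have hρ : AnalyticAt ℂ rhoArch zn := analyticAt_rhoArch_of_im_ne_zero him
  -- the analytic function `F = ρ_∞ · g₀` and its divided difference
  set F : ℂ → ℂ := fun z => rhoArch z * g₀ z with hF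
  have hFan : AnalyticAt ℂ F zn := hρ.mul hg₀
  obtain ⟨q, hq⟩ := hFan
  refine ⟨dslope F zn, ⟨_, hq.has_fpower_series_dslope_fslope⟩, ?_⟩
  filter_upwards [hev, self_mem_nhdsWithin] with z hz hz'
  have hz'' : z - zn ≠ 0 := sub_ne_zero.2 hz'
  rw [dslope_of_ne F hz', slope_def_field, hF]
  simp only
  rw [hval, hz, zpow_neg, zpow_one, smul_eq_mul]
  field_simp


/-! ## 13. The actual polar part of `ρ_∞ρ_p` at the poles `−2n`: coefficients `ρ_p(−2n)·Res_{−2n}ρ_∞` -/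

/-- RH-FREE. **The residue of `ρ_∞ρ_p` at `z = −2n`** (`n ≥ 1`): `ρ_p(−2n)·Res_{−2n}ρ_∞ = −(4n+1)·thm44Coeff p n`
(first printed form of the display «φ₁»: «`ρ_p(−2n)·√π 2π^{2n}(−1)^n/(Γ(n+1)Γ(n+½))`»).
[cite: ConnesConsani2021QuasiInner, Prop 4.5 proof, display φ₁, first form (arXiv chunk p0013:L36); Thm 4.4 proof (p0012:L7)] -/
def archProductResCoeff (p n : ℕ) : ℝ := -(4 * (n : ℝ) + 1) * thm44Coeff p n

/-- RH-FREE. **`archProductResCoeff p n = ρ_p(−2n) · Res_{−2n}ρ_∞`** with `ρ_p(−2n) = (1 − p^{−(2n+1)})/(1 − p^{2n})`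
and `Res_{−2n}ρ_∞ = (−1)^n 2√π π^{2n}/(n! Γ(n+½))` (the value `Φ(−2n)` of t17's `exists_rhoArch_eq_div_sub_pole`),
`p ≥ 2`, `n ≥ 1`. [cite: ConnesConsani2021QuasiInner, §2 (arXiv chunk p0005:L94–L104); Prop 4.5 proof (p0013:L36)] -/
theorem archProductResCoeff_eq {p n : ℕ} (hp : 2 ≤ p) (hn : 1 ≤ n) :
    archProductResCoeff p n =
      (1 - ((p : ℝ) ^ (2 * n + 1))⁻¹) / (1 - (p : ℝ) ^ (2 * n)) *
        ((-1 : ℝ) ^ n * 2 * (Real.sqrt π * π ^ (2 * n)) / (n ! * Real.Gamma (n + 1 / 2))) := by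
  rw [archProductResCoeff, thm44Coeff_eq_thm23Coeff_mul hp hn, thm23Coeff, Real.Gamma_nat_eq_factorial]
  have h1 : (4 * (n : ℝ) + 1) ≠ 0 := by positivity
  have h2 : ((n ! : ℕ) : ℝ) ≠ 0 := by positivity
  have h3 : Real.Gamma ((n : ℝ) + 1 / 2) ≠ 0 := (Real.Gamma_pos_of_pos (by positivity)).ne'
  field_simp
  ring

/-- RH-FREE. `ρ_p(−2n) = (1 − p^{−(2n+1)})/(1 − p^{2n})` (unfolding t17's `rhoPrime`). [cite: ConnesConsani2021QuasiInner, §3 first display (arXiv chunk p0008:L6)] -/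
theorem rhoPrime_neg_two_mul {p : ℕ} (hp : 2 ≤ p) (n : ℕ) :
    rhoPrime p (-(2 * (n : ℂ))) = (((1 - ((p : ℝ) ^ (2 * n + 1))⁻¹) / (1 - (p : ℝ) ^ (2 * n)) : ℝ) : ℂ) := by
  have hp0 : (p : ℂ) ≠ 0 := Nat.cast_ne_zero.2 (by omega)
  rw [rhoPrime]
  have e1 : (p : ℂ) ^ (-(2 * (n : ℂ)) - 1) = (((p : ℝ) ^ (2 * n + 1))⁻¹ : ℝ) := by
    rw [show (-(2 * (n : ℂ)) - 1) = -((2 * n + 1 : ℕ) : ℂ) by push_cast; ring, cpow_neg, cpow_natCast]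
    push_cast; ring
  have e2 : (p : ℂ) ^ (-(-(2 * (n : ℂ)))) = (((p : ℝ) ^ (2 * n) : ℝ) : ℂ) := by
    rw [neg_neg, show (2 * (n : ℂ)) = ((2 * n : ℕ) : ℂ) by push_cast; ring, cpow_natCast]
    push_cast; ring
  rw [e1, e2]
  push_cast
  ring

/-- RH-FREE. **The polar part of `ρ_∞ρ_p` at the poles `−2n`, `n ≥ 1`** (first printed form):
`Σ_{n ≥ 1} ρ_p(−2n)·Res_{−2n}ρ_∞/(z + 2n)` (as a `tsum` over `n + 1`).
[cite: ConnesConsani2021QuasiInner, Prop 4.5 proof, display φ₁, first form (arXiv chunk p0013:L36)] -/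
def archProductPolarPartRes (p : ℕ) (z : ℂ) : ℂ :=
  ∑' n : ℕ, (archProductResCoeff p (n + 1) : ℂ) / (z + 2 * ((n : ℂ) + 1))

/-- RH-FREE. `|ρ_p(−2n)Res_{−2n}ρ_∞| ≤ (4n+1)·4√π π^{2n}/n!` (`p ≥ 2`, `n ≥ 1`). [cite: ConnesConsani2021QuasiInner, Thm 2.3 (arXiv chunk p0006:L49); Prop 4.5 proof (p0013:L36)] -/
theorem abs_archProductResCoeff_le {p n : ℕ} (hp : 2 ≤ p) (hn : 1 ≤ n) :
    |archProductResCoeff p n| ≤ (4 * (n : ℝ) + 1) * (4 * Real.sqrt π * (π ^ 2) ^ n / n !) := by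
  rw [archProductResCoeff, abs_mul, abs_neg, abs_of_pos (by positivity : (0 : ℝ) < 4 * n + 1)]
  exact mul_le_mul_of_nonneg_left (abs_thm44Coeff_le hp hn) (by positivity)

/-- RH-FREE. The majorant `20√π (π²)^{n+1}/n!` of the shifted coefficients is summable. [folklore] -/
private theorem summable_res_majorant :
    Summable fun n : ℕ => 20 * Real.sqrt π * (π ^ 2) ^ (n + 1) / n ! := by
  have h := (Real.summable_pow_div_factorial (π ^ 2)).mul_left (20 * Real.sqrt π * π ^ 2)
  refine h.congr (fun n => ?_)
  simp only [pow_succ]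
  ring

/-- RH-FREE. `|coeff_{n+1}| ≤ 20√π (π²)^{n+1}/n!`. [folklore] -/
private theorem abs_archProductResCoeff_succ_le {p : ℕ} (hp : 2 ≤ p) (n : ℕ) :
    |archProductResCoeff p (n + 1)| ≤ 20 * Real.sqrt π * (π ^ 2) ^ (n + 1) / n ! := by
  have h := abs_archProductResCoeff_le hp (by omega : 1 ≤ n + 1)
  have hfac : ((n + 1) ! : ℝ) = (n + 1) * n ! := by
    rw [Nat.factorial_succ]; push_cast; ring
  have hn0 : (0 : ℝ) < n ! := by positivity
  have hn1 : (0 : ℝ) < (n : ℝ) + 1 := by positivity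
  calc |archProductResCoeff p (n + 1)| ≤ (4 * ((n + 1 : ℕ) : ℝ) + 1) * (4 * Real.sqrt π * (π ^ 2) ^ (n + 1) / (n + 1) !) := h
    _ = (4 * (n : ℝ) + 5) / ((n : ℝ) + 1) * (4 * Real.sqrt π * (π ^ 2) ^ (n + 1) / n !) := by
        rw [hfac]; push_cast
        field_simp
        ring
    _ ≤ 5 * (4 * Real.sqrt π * (π ^ 2) ^ (n + 1) / n !) := by
        refine mul_le_mul_of_nonneg_right ?_ (by positivity)
        rw [div_le_iff₀ hn1]; linarith
    _ = 20 * Real.sqrt π * (π ^ 2) ^ (n + 1) / n ! := by ring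

/-- RH-FREE. Termwise domination of the true polar part on `{Re z > −1}`. [cite: ConnesConsani2021QuasiInner, Prop 4.5 proof (arXiv chunk p0013:L36–L37)] -/
theorem norm_archProductPolarResTerm_le {p : ℕ} (hp : 2 ≤ p) {z : ℂ} (hz : -1 < z.re) (n : ℕ) :
    ‖(archProductResCoeff p (n + 1) : ℂ) / (z + 2 * ((n : ℂ) + 1))‖ ≤ 20 * Real.sqrt π * (π ^ 2) ^ (n + 1) / n ! := by
  have hre : (z + 2 * ((n : ℂ) + 1)).re = z.re + 2 * (n + 1) := by simp
  have hd1 : (1 : ℝ) ≤ ‖z + 2 * ((n : ℂ) + 1)‖ := by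
    have h := abs_re_le_norm (z + 2 * ((n : ℂ) + 1))
    rw [hre] at h
    have : (1 : ℝ) ≤ |z.re + 2 * (n + 1)| := by
      have h0 : (0 : ℝ) ≤ n := n.cast_nonneg
      rw [abs_of_pos (by linarith)]
      linarith
    exact this.trans h
  rw [norm_div, Complex.norm_real, Real.norm_eq_abs]
  calc |archProductResCoeff p (n + 1)| / ‖z + 2 * ((n : ℂ) + 1)‖ ≤ |archProductResCoeff p (n + 1)| / 1 :=
        div_le_div_of_nonneg_left (abs_nonneg _) one_pos hd1
    _ = |archProductResCoeff p (n + 1)| := div_one _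
    _ ≤ _ := abs_archProductResCoeff_succ_le hp n

/-- RH-FREE. The true polar part is continuous on `{Re z > −1}`. [cite: ConnesConsani2021QuasiInner, Prop 4.5 proof (arXiv chunk p0013:L36–L37)] -/
theorem continuousOn_archProductPolarPartRes {p : ℕ} (hp : 2 ≤ p) :
    ContinuousOn (archProductPolarPartRes p) {z | -1 < z.re} := by
  refine continuousOn_tsum (fun n => ?_) summable_res_majorant (fun n z hz => norm_archProductPolarResTerm_le hp hz n)
  refine continuousOn_const.div (continuousOn_id.add continuousOn_const) (fun z hz => ?_)
  intro h
  have := congrArg Complex.re h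
  simp at this
  have h0 : (0 : ℝ) ≤ n := n.cast_nonneg
  have hz' : -1 < z.re := hz
  linarith

/-- RH-FREE. … and continuous at every point of `{Re z > −1}`. [cite: ConnesConsani2021QuasiInner, Prop 4.5 proof (arXiv chunk p0013:L36–L37)] -/
theorem continuousAt_archProductPolarPartRes {p : ℕ} (hp : 2 ≤ p) {z : ℂ} (hz : -1 < z.re) :
    ContinuousAt (archProductPolarPartRes p) z :=
  (continuousOn_archProductPolarPartRes hp).continuousAt
    ((isOpen_lt continuous_const Complex.continuous_re).mem_nhds hz)

/-- RH-FREE. The true polar part tends to `0` along vertical lines `Re z = σ > −1`. [cite: ConnesConsani2021QuasiInner, Prop 4.5 proof (arXiv chunk p0013:L36–L37)] -/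
theorem tendsto_archProductPolarPartRes_vertical {p : ℕ} (hp : 2 ≤ p) {σ : ℝ} (hσ : -1 < σ) :
    Tendsto (fun s : ℝ => archProductPolarPartRes p ((σ : ℂ) + s * I)) (cocompact ℝ) (𝓝 0) := by
  have hre : ∀ s : ℝ, -1 < ((σ : ℂ) + s * I).re := fun s => by simpa using hσ
  have h := tendsto_tsum_of_dominated_convergence (𝓕 := cocompact ℝ)
    (f := fun (s : ℝ) (n : ℕ) => (archProductResCoeff p (n + 1) : ℂ) / (((σ : ℂ) + s * I) + 2 * ((n : ℂ) + 1)))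
    (g := fun _ => (0 : ℂ)) (bound := fun n => 20 * Real.sqrt π * (π ^ 2) ^ (n + 1) / n !)
    summable_res_majorant ?_ (Filter.Eventually.of_forall fun s n => norm_archProductPolarResTerm_le hp (hre s) n)
  · simpa [archProductPolarPartRes] using h
  · intro n
    have hden : Tendsto (fun s : ℝ => ‖((σ : ℂ) + s * I) + 2 * ((n : ℂ) + 1)‖) (cocompact ℝ) atTop := by
      refine tendsto_atTop_mono (fun s => ?_) (tendsto_norm_cocompact_atTop (E := ℝ))
      have h := abs_im_le_norm (((σ : ℂ) + s * I) + 2 * ((n : ℂ) + 1))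
      simpa [Real.norm_eq_abs] using h
    have h0 : Tendsto (fun s : ℝ => ‖(archProductResCoeff p (n + 1) : ℂ)‖ *
        ‖((σ : ℂ) + s * I) + 2 * ((n : ℂ) + 1)‖⁻¹) (cocompact ℝ) (𝓝 0) := by
      have h := hden.inv_tendsto_atTop.const_mul ‖(archProductResCoeff p (n + 1) : ℂ)‖
      rw [mul_zero] at h
      exact h
    refine squeeze_zero_norm (fun s => ?_) h0
    rw [norm_div, div_eq_mul_inv]

/-- RH-FREE. **The true polar part pulls back to `C(S¹)`.** [cite: ConnesConsani2021QuasiInner, Prop 4.5 proof (arXiv chunk p0013:L36–L37)] -/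
theorem continuous_circlePullback_archProductPolarPartRes {p : ℕ} (hp : 2 ≤ p) :
    Continuous (circlePullback (archProductPolarPartRes p)) :=
  continuous_circlePullback (fun z hz => continuousAt_archProductPolarPartRes hp (by rw [hz]; norm_num))
    (tendsto_archProductPolarPartRes_vertical hp (by norm_num))

/-- RH-FREE. **«The sum of the polar parts `πρ^{p,∞} := φ + φ₁ + φ₂` is in `C(S¹)` after composition with
`ψ`»**, with the ACTUAL polar part `φ₁ = archProductPolarPartRes` and `φ₂ = a z⁻² + b z⁻¹` for any `a, b` —
the candidate continuous part `c` of the boundary-value form of `QuasiInner.prop_4_5`.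
[cite: ConnesConsani2021QuasiInner, Prop 4.5 proof (arXiv chunk p0013:L38–L45)] -/
theorem continuous_circlePullback_polarPartsRes {p : ℕ} (hp : p.Prime) (a b : ℂ) :
    Continuous (circlePullback fun z =>
      primePolarPart p z + archProductPolarPartRes p z + (a * z⁻¹ ^ 2 + b * z⁻¹ ^ 1)) := by
  have hp1 : 1 < p := hp.one_lt
  have hp2 : 2 ≤ p := hp.two_le
  refine continuous_circlePullback (fun z hz => ?_) ?_
  · have hz0 : z ≠ 0 := fun h => by rw [h, Complex.zero_re] at hz; norm_num at hz
    have h1 : ContinuousAt (primePolarPart p) z := continuousAt_primePolarPart hp1 (by rw [hz]; norm_num)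
    have h2 : ContinuousAt (archProductPolarPartRes p) z :=
      continuousAt_archProductPolarPartRes hp2 (by rw [hz]; norm_num)
    have h3 : ContinuousAt (fun z : ℂ => a * z⁻¹ ^ 2 + b * z⁻¹ ^ 1) z :=
      (continuousAt_const.mul ((continuousAt_id.inv₀ hz0).pow 2)).add
        (continuousAt_const.mul ((continuousAt_id.inv₀ hz0).pow 1))
    exact (h1.add h2).add h3
  · have h := ((tendsto_primePolarPart_vertical hp1 (σ := 1 / 2) (by norm_num)).add
      (tendsto_archProductPolarPartRes_vertical hp2 (σ := 1 / 2) (by norm_num))).add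
      (((tendsto_inv_pow_vertical (k := 2) (by norm_num)).const_mul a).add
        ((tendsto_inv_pow_vertical (k := 1) le_rfl).const_mul b))
    simpa using h

/-- RH-FREE. The true polar part is bounded off the `r₀`-neighbourhoods of its poles, uniformly on `ℂ`.
[cite: ConnesConsani2021QuasiInner, Prop 4.5 proof (arXiv chunk p0013:L38–L39)] -/
theorem norm_archProductPolarPartRes_le_of_forall_le_norm_add {p : ℕ} (hp : 2 ≤ p) {r₀ : ℝ} (hr : 0 < r₀) :
    ∃ C : ℝ, ∀ z : ℂ, (∀ n : ℕ, r₀ ≤ ‖z + 2 * ((n : ℂ) + 1)‖) → ‖archProductPolarPartRes p z‖ ≤ C := by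
  refine ⟨r₀⁻¹ * ∑' n : ℕ, 20 * Real.sqrt π * (π ^ 2) ^ (n + 1) / n !, fun z hz => ?_⟩
  have hle : ∀ n : ℕ, ‖(archProductResCoeff p (n + 1) : ℂ) / (z + 2 * ((n : ℂ) + 1))‖ ≤
      r₀⁻¹ * (20 * Real.sqrt π * (π ^ 2) ^ (n + 1) / n !) := fun n => by
    have hd : 0 < ‖z + 2 * ((n : ℂ) + 1)‖ := lt_of_lt_of_le hr (hz n)
    rw [norm_div, Complex.norm_real, Real.norm_eq_abs, div_eq_mul_inv, mul_comm]
    refine mul_le_mul ?_ (abs_archProductResCoeff_succ_le hp n) (abs_nonneg _) (by positivity)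
    exact (inv_le_inv₀ hd hr).2 (hz n)
  have hs : Summable fun n : ℕ => r₀⁻¹ * (20 * Real.sqrt π * (π ^ 2) ^ (n + 1) / n !) :=
    summable_res_majorant.mul_left _
  calc ‖archProductPolarPartRes p z‖ ≤ ∑' n : ℕ, ‖(archProductResCoeff p (n + 1) : ℂ) / (z + 2 * ((n : ℂ) + 1))‖ :=
        norm_tsum_le_tsum_norm (Summable.of_nonneg_of_le (fun n => norm_nonneg _) hle hs)
    _ ≤ ∑' n : ℕ, r₀⁻¹ * (20 * Real.sqrt π * (π ^ 2) ^ (n + 1) / n !) :=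
        Summable.tsum_le_tsum hle (Summable.of_nonneg_of_le (fun n => norm_nonneg _) hle hs) hs
    _ = r₀⁻¹ * ∑' n : ℕ, 20 * Real.sqrt π * (π ^ 2) ^ (n + 1) / n ! := tsum_mul_left


/-! ## 14. Removable singularities of `ρ_∞ρ_p − φ₁` at the poles `−2n` of `ρ_∞` -/

/-- RH-FREE. **Removable singularity of `ρ_∞ρ_p` minus the `n`-th true polar term at `−2n` (`n ≥ 1`, `p` prime)**:
near the simple pole `−2n` of `ρ_∞` (t17's `exists_rhoArch_eq_div_sub_pole`: `ρ_∞ = Φ/(z + 2n)`, `Φ(−2n) = Res_{−2n}ρ_∞`),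
where `ρ_p` is analytic (its poles are purely imaginary), `ρ_∞(z)ρ_p(z) − archProductResCoeff p n/(z + 2n)` agrees on
a punctured neighbourhood with a function analytic at `−2n` («The contribution of the non-zero poles of `ρ_∞` is
of the form `φ₁(z) := Σ ρ_p(−2n)·Res·(z+2n)⁻¹`»).
[cite: ConnesConsani2021QuasiInner, Prop 4.5 proof, display φ₁ (arXiv chunk p0013:L36); §2 (p0005:L94–L104)] -/
theorem exists_analyticAt_rhoArch_mul_rhoPrime_sub_polar_neg {p : ℕ} (hp : p.Prime) {n : ℕ} (hn : 1 ≤ n) :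
    ∃ g : ℂ → ℂ, AnalyticAt ℂ g (-(2 * (n : ℂ))) ∧
      ∀ᶠ z in 𝓝[≠] (-(2 * (n : ℂ))),
        rhoArch z * rhoPrime p z - (archProductResCoeff p n : ℂ) / (z + 2 * (n : ℂ)) = g z := by
  have hp1 : 1 < p := hp.one_lt
  have hp2 : 2 ≤ p := hp.two_le
  have hlog : 0 < Real.log p := Real.log_pos (by exact_mod_cast hp1)
  set z₀ : ℂ := -(2 * (n : ℂ)) with hz₀
  obtain ⟨Φ, hΦd, hΦ0, hΦ⟩ := exists_rhoArch_eq_div_sub_pole n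
  -- `ρ_p` is analytic at the real point `−2n ≠ 2πik/log p`
  have hne : ∀ k : ℤ, z₀ ≠ 2 * π * I * k / Real.log p := fun k h => by
    have h1 := congrArg Complex.re h
    rw [show (2 * (π : ℂ) * I * (k : ℂ) / (Real.log p : ℂ)) = primePole p k from rfl, primePole_re, hz₀] at h1
    simp at h1
    have hn0 : n = 0 := by exact_mod_cast h1
    omega
  have hρp : AnalyticAt ℂ (rhoPrime p) z₀ := (lemma_3_1_ii_holds p hp).2.1 z₀ hne
  have hΦa : AnalyticAt ℂ Φ z₀ := hΦd.analyticAt (Metric.ball_mem_nhds _ one_pos)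
  -- the coefficient is `Φ(−2n)·ρ_p(−2n)`
  have hcoeff : (archProductResCoeff p n : ℂ) = Φ z₀ * rhoPrime p z₀ := by
    rw [hz₀, hΦ0, rhoPrime_neg_two_mul hp2 n, archProductResCoeff_eq hp2 hn]
    push_cast
    ring
  set F : ℂ → ℂ := fun z => Φ z * rhoPrime p z with hF
  have hFan : AnalyticAt ℂ F z₀ := hΦa.mul hρp
  obtain ⟨q, hq⟩ := hFan
  refine ⟨dslope F z₀, ⟨_, hq.has_fpower_series_dslope_fslope⟩, ?_⟩
  have hball : ∀ᶠ z in 𝓝[≠] z₀, z ∈ Metric.ball z₀ 1 :=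
    mem_nhdsWithin_of_mem_nhds (Metric.ball_mem_nhds _ one_pos)
  filter_upwards [hball, self_mem_nhdsWithin] with z hz hz'
  have hz'' : z - z₀ ≠ 0 := sub_ne_zero.2 hz'
  have hzz : z + 2 * (n : ℂ) = z - z₀ := by rw [hz₀]; ring
  rw [dslope_of_ne F hz', slope_def_field, hF]
  simp only
  rw [hΦ z hz hz', hcoeff, hzz, show z - -(2 * (n : ℂ)) = z - z₀ by rw [hz₀]]
  field_simp

end QuasiInner

end Literature.NumberTheory.ConnesConsani2021

end
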